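import Literature.Computability.Complexity.SuccinctKernelVectorCircuit
import Literature.LinearAlgebra.KernelVectorViaCharpoly
import Literature.Computability.AlgebraicComplexity.CharpolyCoefficientsExplicitABP
import HarnessLib

/-!
# The succinct kernel-vector circuit, III: the values of its gates (val-lit KV20 M1 programme,
# step (P6), file B2)

Sequel of `SuccinctKernelVectorGates.lean` / `SuccinctKernelVectorCircuit.lean` (the circuit
`KVC.kvc Φ : SuccCircuit` of an integer matrix family `Φ : SuccIntMatrixFamily`). Here the VALUES
of its canonical gates are identified, tag by tag, with the positive and negative parts of the
integers of the kernel-vector computation for `B = A_nᵀ A_n` ("standard small-space linear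
algebra", the sentence of Kumar–Volk's proof of Cor. 1.3): `b = AᵀA`; the reindexed
all-coefficients Mahajan–Vinay matrix `m̂` (`AC/CharpolyCoefficientsExplicitABP.lean`, t20 g10) and
its `2^t`-th powers; the coefficients `c_i` of `χ_B`; the binary powers `B^j`;
`q_B(B)·B^j = Σ_i c_{i+k_B} B^{i+j}` selected by `[c_0 = ⋯ = c_{k'-1} = 0 ≠ c_{k'}]`; the kernel
matrix `N_B = q_B(B)·B^{j₀-1}` selected by `[q_B(B)B^{j'+1} = 0 ≠ q_B(B)B^{j'}]`; and its least
nonzero column — ending in ★ `KVC.val_V`: `val V(0,r) − val V(1,r) = charpolyKernelVector B r`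
(`Literature/LinearAlgebra/KernelVectorViaCharpoly.lean`, x5 g6). Every select gate is exact because
all canonical values are below `2^{Wmux}` (`val_lt_Wmux`, from the generic bound of
`SuccinctCircuitNames.lean`).

HONEST FRAMING (val-lit, KV20 M1 programme, RULING (120)): the algebraic half of the machine step
(P6); proves nothing about `kumarVolk2020_cor_1_3` by itself (census +0); `VP ≠ VNP` is NOT proved.

## References

* M. Kumar, B. L. Volk, ACM TOCT 14 (2022) = arXiv:2003.12938, §6 (proof of Cor. 1.3: "solving a
  linear system … of dimension exp(poly(n)) … standard small-space linear algebra [BvzGH82, ABO99]")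
  [KumarVolk2022].
* A. Borodin, J. von zur Gathen, J. Hopcroft, Inform. and Control 52 (1982), §4 (rank via the order
  of the characteristic polynomial at `0`) and §5 (NULLSPACE) [BorodinVonzurgathenHopcroft1982].
* M. Mahajan, V. Vinay, SIAM J. Discrete Math. 12 (1999), Thm. 3.2 and §3.1 [MahajanVinay1999].
* P. Koiran, S. Perifel, Comput. Complexity 18 (2009), §3.2 Prop. 1 [KoiranPerifel2009VPSPACE].
-/

noncomputable section

namespace Literature.Computability.Complexity

open _root_.Computability CodeFP Brick Finset CodeFP.AExp
open Literature.LinearAlgebra Literature.Computability.AlgebraicComplexity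
open Literature.Barriers.ValiantsHypothesis

namespace KVC

open SuccCircuit

variable (Φ : SuccIntMatrixFamily) (n : ℕ)

/-! ### Canonical gate names of the `n`-th circuit -/

/-- The canonical name of the gate `[c, s, f1, …, f6]` of the `n`-th circuit (padded to `Lreq n`).
[cite: KoiranPerifel2009VPSPACE, §3.2] -/
def G (c s f1 f2 f3 f4 f5 f6 : ℕ) : List Bool := gname (Φ.Lreq n) n [c, s, f1, f2, f3, f4, f5, f6]

/-- The value of a canonical gate. [cite: KoiranPerifel2009VPSPACE, §3.2, Prop. 1] -/
def V (c s f1 f2 f3 f4 f5 f6 : ℕ) : ℕ := (kvc Φ).val (G Φ n c s f1 f2 f3 f4 f5 f6)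

variable {n}
variable {c s f1 f2 f3 f4 f5 f6 : ℕ}

/-- A well-formed canonical tuple fits in the canonical length. [cite: KoiranPerifel2009VPSPACE, §3.2] -/
theorem fitsL (h : WF Φ n (Φ.Lreq n) [c, s, f1, f2, f3, f4, f5, f6]) :
    (gcore n [c, s, f1, f2, f3, f4, f5, f6]).length ≤ Φ.Lreq n := by
  have h1 := h.1
  simp only [GWF, List.getD_cons_zero, List.getD_cons_succ] at h1
  obtain ⟨h30, hs, hb1, hb2, hb3, hb4, hb5, hb6, -, -⟩ := h1
  have := Φ.FB_ge n
  exact fits8 Φ (by omega) (by omega) hb1 hb2 hb3 hb4 hb5 hb6 le_rfl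

/-- The kind of a canonical gate. [cite: KoiranPerifel2009VPSPACE, §3.2] -/
theorem K_kind (h : WF Φ n (Φ.Lreq n) [c, s, f1, f2, f3, f4, f5, f6]) :
    (kvc Φ).kind (G Φ n c s f1 f2 f3 f4 f5 f6) = kindX.eval (aenv Φ.params n (Φ.Lreq n) [c, s, f1, f2, f3, f4, f5, f6]) :=
  geval_gname' _ rfl (fitsL Φ h) _

/-- The arity of a canonical gate. [cite: KoiranPerifel2009VPSPACE, §3.2] -/
theorem K_arity (h : WF Φ n (Φ.Lreq n) [c, s, f1, f2, f3, f4, f5, f6]) :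
    (kvc Φ).arity (G Φ n c s f1 f2 f3 f4 f5 f6) = arityX.eval (aenv Φ.params n (Φ.Lreq n) [c, s, f1, f2, f3, f4, f5, f6]) :=
  geval_gname' _ rfl (fitsL Φ h) _

/-- The width of a canonical gate. [cite: KoiranPerifel2009VPSPACE, §3.2] -/
theorem K_width (h : WF Φ n (Φ.Lreq n) [c, s, f1, f2, f3, f4, f5, f6]) :
    (kvc Φ).width (G Φ n c s f1 f2 f3 f4 f5 f6) = widthX.eval (aenv Φ.params n (Φ.Lreq n) [c, s, f1, f2, f3, f4, f5, f6]) :=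
  geval_gname' _ rfl (fitsL Φ h) _

/-- The depth of a canonical gate. [cite: KoiranPerifel2009VPSPACE, §3.2] -/
theorem K_depth (h : WF Φ n (Φ.Lreq n) [c, s, f1, f2, f3, f4, f5, f6]) :
    (kvc Φ).depth (G Φ n c s f1 f2 f3 f4 f5 f6) = depthX.eval (aenv Φ.params n (Φ.Lreq n) [c, s, f1, f2, f3, f4, f5, f6]) :=
  geval_gname' _ rfl (fitsL Φ h) _

/-- The children of a canonical gate. [cite: KoiranPerifel2009VPSPACE, §3.2] -/
theorem K_child (h : WF Φ n (Φ.Lreq n) [c, s, f1, f2, f3, f4, f5, f6]) (k : ℕ) :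
    (kvc Φ).child (G Φ n c s f1 f2 f3 f4 f5 f6) k =
      gname (Φ.Lreq n) n (childX.map (AExp.eval (aenvK Φ.params n (Φ.Lreq n) [c, s, f1, f2, f3, f4, f5, f6] k))) :=
  gchild_gname' _ rfl (fitsL Φ h) _ _

/-- The constant bits of a canonical gate. [cite: KoiranPerifel2009VPSPACE, §3.2, Prop. 1 (input gates)] -/
theorem K_cbit (h : WF Φ n (Φ.Lreq n) [c, s, f1, f2, f3, f4, f5, f6]) (i : ℕ) :
    (kvc Φ).cbit (G Φ n c s f1 f2 f3 f4 f5 f6) i =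
      cbitL ((wf.eval (aenv Φ.params n (Φ.Lreq n) [c, s, f1, f2, f3, f4, f5, f6]), c, s, Φ.A n f1 f2), i) := by
  have hfit := fitsL Φ h
  have hf : gfields 8 (sndF (G Φ n c s f1 f2 f3 f4 f5 f6)) = [c, s, f1, f2, f3, f4, f5, f6] :=
    gfields_gname (t := [c, s, f1, f2, f3, f4, f5, f6]) hfit
  show cbitL (cbitArgs Φ (G Φ n c s f1 f2 f3 f4 f5 f6), i) = _
  unfold cbitArgs
  rw [hf, show geval Φ.params 8 wf (G Φ n c s f1 f2 f3 f4 f5 f6) = _ from geval_gname' (m := 8) _ rfl hfit _]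
  rw [show gidx (G Φ n c s f1 f2 f3 f4 f5 f6) = n from gidx_gname hfit]
  rfl

/-! ### Canonical gates: closure under children and the uniform value bound -/

/-- A canonical well-formed gate of the `n`-th circuit. [cite: KoiranPerifel2009VPSPACE, §3.2] -/
def IsCan (n : ℕ) (g : List Bool) : Prop := ∃ t : List ℕ, t.length = 8 ∧ WF Φ n (Φ.Lreq n) t ∧ g = gname (Φ.Lreq n) n t

/-- Canonical tuples give canonical gates. [cite: KoiranPerifel2009VPSPACE, §3.2] -/
theorem isCan_G (h : WF Φ n (Φ.Lreq n) [c, s, f1, f2, f3, f4, f5, f6]) : IsCan Φ n (G Φ n c s f1 f2 f3 f4 f5 f6) :=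
  ⟨_, rfl, h, rfl⟩

/-- **Children of canonical gates are canonical.** [cite: KoiranPerifel2009VPSPACE, §3.2] -/
theorem isCan_child {g : List Bool} (hg : IsCan Φ n g) {k : ℕ}
    (hk : k < gateFanIn ((kvc Φ).kind g) ((kvc Φ).arity g)) : IsCan Φ n ((kvc Φ).child g k) := by
  obtain ⟨t, ht, hw, rfl⟩ := hg
  obtain ⟨a0, s, f1, f2, f3, f4, f5, f6, rfl⟩ := exists_eq_eight ht
  have hfit := fitsL Φ hw
  rw [kvc_kind, kvc_arity, geval_gname' (m := 8) _ rfl hfit, geval_gname' (m := 8) _ rfl hfit] at hk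
  obtain ⟨-, hwc, -⟩ := step_all Φ rfl hw k hk
  exact ⟨_, by simp [childX], hwc, gchild_gname' (m := 8) _ rfl hfit _ _⟩

/-- **Every canonical gate's value is below `2^{Wmux}`** (so every select of the circuit compares
whole numbers). [cite: KoiranPerifel2009VPSPACE, §3.2, Prop. 1 (proof: values have exponentially many bits)] -/
theorem val_lt_Wmux {g : List Bool} (hg : IsCan Φ n g) : (kvc Φ).val g < 2 ^ Φ.Wmux n := by
  have hb := SuccCircuit.val_lt_two_pow (kvc Φ) (IsCan Φ n) (w := Φ.W₀ n + 1) (a := Φ.Fb n)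
    (fun g k hg hk => isCan_child Φ hg hk)
    (fun g hg h1 h2 h3 => by
      obtain ⟨t, ht, hw, rfl⟩ := hg
      obtain ⟨a0, s, f1, f2, f3, f4, f5, f6, rfl⟩ := exists_eq_eight ht
      have hfit := fitsL Φ hw
      rw [kvc_kind, geval_gname' (m := 8) _ rfl hfit] at h1 h2 h3
      rw [kvc_width, geval_gname' (m := 8) _ rfl hfit]
      exact wbound_all Φ rfl hw h1 h2 h3)
    (fun g hg h1 => by
      obtain ⟨t, ht, hw, rfl⟩ := hg
      obtain ⟨a0, s, f1, f2, f3, f4, f5, f6, rfl⟩ := exists_eq_eight ht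
      have hfit := fitsL Φ hw
      rw [kvc_kind, geval_gname' (m := 8) _ rfl hfit] at h1
      rw [kvc_arity, geval_gname' (m := 8) _ rfl hfit]
      exact abound_all Φ rfl hw h1)
    g hg
  refine hb.trans_le (Nat.pow_le_pow_right (by norm_num) ?_)
  obtain ⟨t, ht, hw, rfl⟩ := hg
  obtain ⟨a0, s, f1, f2, f3, f4, f5, f6, rfl⟩ := exists_eq_eight ht
  have hfit := fitsL Φ hw
  have hd : (kvc Φ).depth (gname (Φ.Lreq n) n [a0, s, f1, f2, f3, f4, f5, f6]) ≤ Φ.dmax n := by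
    rw [kvc_depth, geval_gname' (m := 8) _ rfl hfit]; exact dle_all Φ rfl hw
  unfold SuccIntMatrixFamily.Wmux
  exact Nat.mul_le_mul_left _ (Nat.pow_le_pow_right (by norm_num) hd)

/-- The value of a well-formed canonical gate is below the select width. [cite: KoiranPerifel2009VPSPACE, §3.2] -/
theorem V_lt (h : WF Φ n (Φ.Lreq n) [c, s, f1, f2, f3, f4, f5, f6]) : V Φ n c s f1 f2 f3 f4 f5 f6 < 2 ^ Φ.Wmux n :=
  val_lt_Wmux Φ (isCan_G Φ h)

/-- **Selects are exact on canonical gates**: reduction modulo `2^{Wmux}` is the identity. [cite: KoiranPerifel2009VPSPACE, §3.2] -/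
theorem V_mod (h : WF Φ n (Φ.Lreq n) [c, s, f1, f2, f3, f4, f5, f6]) :
    V Φ n c s f1 f2 f3 f4 f5 f6 % 2 ^ Φ.Wmux n = V Φ n c s f1 f2 f3 f4 f5 f6 := Nat.mod_eq_of_lt (V_lt Φ h)

/-! ### Generic value computations -/

/-- **Pair products**: if `u 0 z − u 1 z = x z` and `v 0 z − v 1 z = y z`, then the sum over
`k < 2Z` of `u (k%2) (k/2) · v ((k%2+s)%2) (k/2)` is the positive (`s = 0`) / negative (`s = 1`) part
of `Σ_{z<Z} x z · y z`. [cite: KoiranPerifel2009VPSPACE, §3.2, Prop. 1 (proof: "for a gate a × b … the sum of the cd")] -/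
theorem pairProd_sub (Z : ℕ) (u v : ℕ → ℕ → ℕ) (x y : ℕ → ℤ)
    (hu : ∀ z, z < Z → (u 0 z : ℤ) - u 1 z = x z) (hv : ∀ z, z < Z → (v 0 z : ℤ) - v 1 z = y z) :
    ((∑ k ∈ range (2 * Z), u (k % 2) (k / 2) * v ((k % 2 + 0) % 2) (k / 2) : ℕ) : ℤ) -
      ((∑ k ∈ range (2 * Z), u (k % 2) (k / 2) * v ((k % 2 + 1) % 2) (k / 2) : ℕ) : ℤ) =
      ∑ z ∈ range Z, x z * y z := by
  induction Z with
  | zero => simp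
  | succ Z ih =>
    have hu' := fun z hz => hu z (Nat.lt_succ_of_lt hz)
    have hv' := fun z hz => hv z (Nat.lt_succ_of_lt hz)
    have hZ := ih hu' hv'
    rw [show 2 * (Z + 1) = 2 * Z + 1 + 1 by ring, sum_range_succ, sum_range_succ, sum_range_succ, sum_range_succ,
      sum_range_succ]
    have e1 : (2 * Z) % 2 = 0 := by omega
    have e2 : (2 * Z) / 2 = Z := by omega
    have e3 : (2 * Z + 1) % 2 = 1 := by omega
    have e4 : (2 * Z + 1) / 2 = Z := by omega
    rw [e1, e2, e3, e4]
    have hx := hu Z (Nat.lt_succ_self _)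
    have hy := hv Z (Nat.lt_succ_self _)
    simp only [Nat.zero_add, Nat.add_zero, Nat.mod_mod, Nat.one_mod,
      show (1 + 1) % 2 = 0 from rfl] at hZ ⊢
    push_cast at hZ ⊢
    rw [← hx, ← hy]
    linear_combination hZ

/-- Sums of parts: `Σ u 0 − Σ u 1 = Σ x`. [cite: KoiranPerifel2009VPSPACE, §3.2, Prop. 1 (proof: "+-gate")] -/
theorem pairSum_sub (Z : ℕ) (u : ℕ → ℕ → ℕ) (x : ℕ → ℤ) (hu : ∀ z, z < Z → (u 0 z : ℤ) - u 1 z = x z) :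
    ((∑ z ∈ range Z, u 0 z : ℕ) : ℤ) - ((∑ z ∈ range Z, u 1 z : ℕ) : ℤ) = ∑ z ∈ range Z, x z := by
  push_cast
  rw [← sum_sub_distrib]
  exact sum_congr rfl fun z hz => hu z (mem_range.1 hz)

/-- The value of a constant gate whose bits are those of a number below `2^{width}`.
[cite: KoiranPerifel2009VPSPACE, §3.2, Prop. 1 (input gates)] -/
theorem cval_eq_of_testBit (K : SuccCircuit) (g : List Bool) (x : ℕ) (hx : x < 2 ^ K.width g)
    (hb : ∀ i, i < K.width g → K.cbit g i = x.testBit i) : K.cval g = x := by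
  apply Nat.eq_of_testBit_eq
  intro i
  rw [K.testBit_cval]
  by_cases hi : i < K.width g
  · simp [hi, hb i hi]
  · simp only [hi, decide_false, Bool.false_and]
    symm
    apply Nat.testBit_eq_false_of_lt
    exact hx.trans_le (Nat.pow_le_pow_right (by norm_num) (by omega))

/-! ### Tags `ONE`, `ZERO`, `A`, `PA`, `B`: the Gram matrix -/

section Gram
variable {n : ℕ}

/-- `ONE` is worth `1`. [cite: KoiranPerifel2009VPSPACE, §3.2, Prop. 1 (input gates)] -/
theorem V_ONE (h : WF Φ n (Φ.Lreq n) [0, s, f1, f2, f3, f4, f5, f6]) : V Φ n 0 s f1 f2 f3 f4 f5 f6 = 1 := by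
  have hk := K_kind Φ h; rw [kind_ONE Φ h] at hk
  unfold V
  rw [(kvc Φ).val_const (by rw [hk]; norm_num) (by rw [hk]; norm_num) (by rw [hk]; norm_num)]
  apply cval_eq_of_testBit
  · rw [K_width Φ h, width_ONE Φ h]; norm_num
  · intro i hi
    rw [K_width Φ h, width_ONE Φ h] at hi
    rw [K_cbit Φ h, cbitL]
    have hw : 0 < wf.eval (aenv Φ.params n (Φ.Lreq n) [0, s, f1, f2, f3, f4, f5, f6]) := (wf_iff Φ).2 h
    simp only [Nat.ne_of_gt hw, if_false, if_true]
    interval_cases i; rfl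

/-- `ZERO` is worth `0`. [cite: KoiranPerifel2009VPSPACE, §3.2, Prop. 1 (input gates)] -/
theorem V_ZERO (h : WF Φ n (Φ.Lreq n) [30, s, f1, f2, f3, f4, f5, f6]) : V Φ n 30 s f1 f2 f3 f4 f5 f6 = 0 := by
  have hk := K_kind Φ h; rw [kind_ZERO Φ h] at hk
  unfold V
  rw [(kvc Φ).val_const (by rw [hk]; norm_num) (by rw [hk]; norm_num) (by rw [hk]; norm_num)]
  apply cval_eq_of_testBit
  · positivity
  · intro i hi; rw [K_width Φ h, width_ZERO Φ h] at hi; omega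

/-- The positive (`s = 0`) or negative (`s = 1`) part of an integer is below `2^W` when `|z| < 2^W`. [folklore] -/
private theorem ipart_lt {z : ℤ} {W : ℕ} (hz : z.natAbs < 2 ^ W) (s : ℕ) : ipart s z < 2 ^ W := by
  unfold ipart; split_ifs <;> omega

/-- The two parts recover the integer. [folklore] -/
private theorem ipart_sub (z : ℤ) : (ipart 0 z : ℤ) - ipart 1 z = z := by
  unfold ipart; simp only [if_true, show (1:ℕ) ≠ 0 by norm_num, if_false]; omega

/-- **`A(s,r,c)` is worth the `s`-part of the entry `A n r c`.** [cite: KoiranPerifel2009VPSPACE, §3.2, Prop. 1 (input gates)] -/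
theorem V_A (h : WF Φ n (Φ.Lreq n) [1, s, f1, f2, f3, f4, f5, f6]) :
    V Φ n 1 s f1 f2 f3 f4 f5 f6 = ipart s (Φ.A n f1 f2) := by
  have hk := K_kind Φ h; rw [kind_A Φ h] at hk
  unfold V
  rw [(kvc Φ).val_const (by rw [hk]; norm_num) (by rw [hk]; norm_num) (by rw [hk]; norm_num)]
  apply cval_eq_of_testBit
  · rw [K_width Φ h, width_A Φ h]; exact ipart_lt (Φ.natAbs_lt n f1 f2) s
  · intro i _
    rw [K_cbit Φ h, cbitL]
    have hw : 0 < wf.eval (aenv Φ.params n (Φ.Lreq n) [1, s, f1, f2, f3, f4, f5, f6]) := (wf_iff Φ).2 h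
    simp only [Nat.ne_of_gt hw, if_false, show (1:ℕ) ≠ 0 by norm_num, if_true]

/-- The entries as integers: `A⁺ − A⁻ = A n r c`. [cite: KumarVolk2022, §6 (proof of Cor. 1.3)] -/
theorem V_A_sub (h0 : WF Φ n (Φ.Lreq n) [1, 0, f1, f2, 0, 0, 0, 0]) (h1 : WF Φ n (Φ.Lreq n) [1, 1, f1, f2, 0, 0, 0, 0]) :
    (V Φ n 1 0 f1 f2 0 0 0 0 : ℤ) - V Φ n 1 1 f1 f2 0 0 0 0 = Φ.A n f1 f2 := by
  rw [V_A Φ h0, V_A Φ h1]; exact ipart_sub _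

/-- The Gram matrix `b c c' = Σ_{r<R} A n r c · A n r c'` on natural indices. [cite: KumarVolk2022, §6 (proof of Cor. 1.3)] -/
def bZ (n c c' : ℕ) : ℤ := ∑ r ∈ range (Φ.R n), Φ.A n r c * Φ.A n r c'

/-- `PA(s,c,c',k)` is the product of its two `A` children. [cite: KoiranPerifel2009VPSPACE, §3.2, Prop. 1 (gate a × b)] -/
theorem V_PA (h : WF Φ n (Φ.Lreq n) [3, s, f1, f2, f3, f4, f5, f6]) :
    V Φ n 3 s f1 f2 f3 f4 f5 f6 = V Φ n 1 (f3 % 2) (f3 / 2) f1 0 0 0 0 * V Φ n 1 ((f3 % 2 + s) % 2) (f3 / 2) f2 0 0 0 0 := by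
  have hk := K_kind Φ h; rw [kind_PA Φ h] at hk
  unfold V
  rw [(kvc Φ).val_mul hk, K_child Φ h, K_child Φ h, child_PA_0, child_PA_1]
  rfl

/-- `B(s,c,c')` is the sum of its `2R` children `PA`. [cite: KoiranPerifel2009VPSPACE, §3.2, Prop. 1 (+-gate)] -/
theorem V_B (h : WF Φ n (Φ.Lreq n) [2, s, f1, f2, f3, f4, f5, f6]) :
    V Φ n 2 s f1 f2 f3 f4 f5 f6 = ∑ k ∈ range (2 * Φ.R n), V Φ n 3 s f1 f2 k 0 0 0 := by
  have hk := K_kind Φ h; rw [kind_B Φ h] at hk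
  unfold V
  rw [(kvc Φ).val_sum hk, K_arity Φ h, arity_B Φ h]
  refine sum_congr rfl fun k _ => ?_
  rw [K_child Φ h, child_B]; rfl

/-- ★ **`B⁺ − B⁻ = (AᵀA) c c'`.** [cite: KumarVolk2022, §6 (proof of Cor. 1.3: the linear system); KoiranPerifel2009VPSPACE, §3.2, Prop. 1] -/
theorem V_B_sub (hN : 0 < Φ.N n) (hc : f1 < Φ.N n) (hc' : f2 < Φ.N n) :
    (V Φ n 2 0 f1 f2 0 0 0 0 : ℤ) - V Φ n 2 1 f1 f2 0 0 0 0 = bZ Φ n f1 f2 := by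
  obtain ⟨hFB, h2X, h2R, h2NN, h2N1, hXeq, hTF, hTFB, hLreq⟩ := Φ.param_facts n
  have hwB : ∀ s, s ≤ 1 → WF Φ n (Φ.Lreq n) [2, s, f1, f2, 0, 0, 0, 0] := fun s hs =>
    (wf_B Φ).2 ⟨⟨by omega, hs, by omega, by omega, by omega, by omega, by omega, by omega, le_rfl, hN⟩, hc, hc'⟩
  have hwPA : ∀ s k, s ≤ 1 → k < 2 * Φ.R n → WF Φ n (Φ.Lreq n) [3, s, f1, f2, k, 0, 0, 0] := fun s k hs hk =>
    (wf_PA Φ).2 ⟨⟨by omega, hs, by omega, by omega, by omega, by omega, by omega, by omega, le_rfl, hN⟩, hc, hc', hk⟩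
  have hwA : ∀ s r c, s ≤ 1 → r < Φ.R n → c < Φ.N n → WF Φ n (Φ.Lreq n) [1, s, r, c, 0, 0, 0, 0] :=
    fun s r c hs hr hcc =>
    (wf_A Φ).2 ⟨⟨by omega, hs, by omega, by omega, by omega, by omega, by omega, by omega, le_rfl, hN⟩, hr, hcc⟩
  rw [V_B Φ (hwB 0 (by norm_num)), V_B Φ (hwB 1 (by norm_num))]
  have hsum : ∀ s, s ≤ 1 → ∑ k ∈ range (2 * Φ.R n), V Φ n 3 s f1 f2 k 0 0 0 =
      ∑ k ∈ range (2 * Φ.R n), V Φ n 1 (k % 2) (k / 2) f1 0 0 0 0 * V Φ n 1 ((k % 2 + s) % 2) (k / 2) f2 0 0 0 0 :=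
    fun s hs => sum_congr rfl fun k hk => V_PA Φ (hwPA s k hs (mem_range.1 hk))
  rw [hsum 0 (by norm_num), hsum 1 (by norm_num), bZ]
  exact pairProd_sub (Φ.R n) (fun e r => V Φ n 1 e r f1 0 0 0 0) (fun e r => V Φ n 1 e r f2 0 0 0 0)
    (fun r => Φ.A n r f1) (fun r => Φ.A n r f2)
    (fun r hr => V_A_sub Φ (hwA 0 r f1 (by norm_num) hr hc) (hwA 1 r f1 (by norm_num) hr hc))
    (fun r hr => V_A_sub Φ (hwA 0 r f2 (by norm_num) hr hc') (hwA 1 r f2 (by norm_num) hr hc'))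

end Gram


/-! ### Tag `M`: the reindexed all-coefficients matrix, by label decoding -/

section MGate
variable (n : ℕ)

/-- `N − 2` (the all-coefficients program is stated for `(N'+2) × (N'+2)` matrices). [cite: MahajanVinay1999, §3.1] -/
def N2 : ℕ := Φ.N n - 2

/-- The Gram matrix `AᵀA` as a matrix over `Fin (N'+2)`. [cite: KumarVolk2022, §6 (proof of Cor. 1.3)] -/
def Bfin : Matrix (Fin (N2 Φ n + 2)) (Fin (N2 Φ n + 2)) ℤ := Matrix.of fun i j => bZ Φ n i j

/-- The number of labels `1 + (N'+1)(N'+2)² + (N'+3)`. [cite: MahajanVinay1999, §3.1] -/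
def XL : ℕ := 1 + ((N2 Φ n + 1) * ((N2 Φ n + 2) * (N2 Φ n + 2)) + (N2 Φ n + 3))

/-- **The label equivalence**: source `↦ 0`, internal state `(ℓ, t, u) ↦ 1 + u + N t + N² ℓ`, sink
`d ↦ 1 + (N−1)N² + d`. [cite: MahajanVinay1999, §3.1 (p0006.txt:L11–47)] -/
def labE : CState (N2 Φ n) ≃ Fin (XL Φ n) :=
  (Equiv.sumCongr finOneEquiv.symm
    ((Equiv.sumCongr (((Equiv.refl (Fin (N2 Φ n + 1))).prodCongr finProdFinEquiv).trans finProdFinEquiv)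
      (Equiv.refl (Fin (N2 Φ n + 3)))).trans finSumFinEquiv)).trans (finSumFinEquiv.trans (finCongr rfl))

/-- The label of the source. [cite: MahajanVinay1999, §3.1] -/
theorem labE_src : (labE Φ n (CState.src (N2 Φ n)) : ℕ) = 0 := by
  simp [labE]

/-- The label of an internal state. [cite: MahajanVinay1999, §3.1] -/
theorem labE_mid (l : Fin (N2 Φ n + 1)) (t u : Fin (N2 Φ n + 2)) :
    (labE Φ n (CState.mid (N2 Φ n) (l, (t, u))) : ℕ) =
      1 + ((u : ℕ) + (N2 Φ n + 2) * t + (N2 Φ n + 2) * (N2 Φ n + 2) * l) := by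
  simp [labE, finProdFinEquiv, Nat.add_assoc]

/-- The label of a sink. [cite: MahajanVinay1999, §3.1] -/
theorem labE_snk (d : Fin (N2 Φ n + 3)) :
    (labE Φ n (CState.snk (N2 Φ n) d) : ℕ) = 1 + ((N2 Φ n + 1) * ((N2 Φ n + 2) * (N2 Φ n + 2)) + d) := by
  simp [labE]

/-- **The reindexed all-coefficients matrix** `m̂ = mvCharAdj (AᵀA)` on labels. [cite: MahajanVinay1999, Thm. 3.2 and §3.1] -/
def Mhat : Matrix (Fin (XL Φ n)) (Fin (XL Φ n)) ℤ :=
  Matrix.reindex (labE Φ n) (labE Φ n) (mvCharAdj (Bfin Φ n))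

/-- Its entries on natural labels (`0` off range). [cite: MahajanVinay1999, §3.1] -/
def mZ (x y : ℕ) : ℤ := if h : x < XL Φ n ∧ y < XL Φ n then Mhat Φ n ⟨x, h.1⟩ ⟨y, h.2⟩ else 0

/-- The entries of its `2^t`-th power on natural labels. [cite: MahajanVinay1999, §3.1] -/
def pZ (t x y : ℕ) : ℤ := if h : x < XL Φ n ∧ y < XL Φ n then (Mhat Φ n ^ 2 ^ t) ⟨x, h.1⟩ ⟨y, h.2⟩ else 0

/-- The value denoted by an `M` gate pair: `[κ = 1] + ([κ = 3] − [κ = 4])·b(a, b)`. [cite: MahajanVinay1999, §3.1] -/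
def mval (x y : ℕ) : ℤ :=
  (if mKapL Φ n x y = 1 then 1 else 0) +
    ((if mKapL Φ n x y = 3 then 1 else 0) - (if mKapL Φ n x y = 4 then 1 else 0)) *
      bZ Φ n (mRowL Φ n x y) (mColL Φ n x y)

variable {n}

/-- `N2_add_two` (plumbing). [cite: AroraBarak2009, §1.3 (polynomial-time arithmetic on binary numerals)] -/
theorem N2_add_two (hN : 2 ≤ Φ.N n) : N2 Φ n + 2 = Φ.N n := by unfold N2; omega

/-- `Lmid_eq` (plumbing). [cite: AroraBarak2009, §1.3 (polynomial-time arithmetic on binary numerals)] -/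
theorem Lmid_eq (hN : 2 ≤ Φ.N n) : Φ.Lmid n = (N2 Φ n + 1) * ((N2 Φ n + 2) * (N2 Φ n + 2)) := by
  unfold SuccIntMatrixFamily.Lmid; rw [← N2_add_two Φ hN]; rfl

/-- `XL_eq` (plumbing). [cite: AroraBarak2009, §1.3 (polynomial-time arithmetic on binary numerals)] -/
theorem XL_eq (hN : 2 ≤ Φ.N n) : XL Φ n = Φ.X n := by
  unfold XL SuccIntMatrixFamily.X; rw [Lmid_eq Φ hN, ← N2_add_two Φ hN]

/-- `entryN_Bfin` (plumbing). [cite: KoiranPerifel2009VPSPACE, §3.2 (Uniform VPAR⁰: the syntax of a gate as a polynomial-time function of its name)] -/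
theorem entryN_Bfin (a b : Fin (N2 Φ n + 2)) : entryN (Bfin Φ n) a b = bZ Φ n a b := by
  unfold entryN Bfin
  rw [dif_pos ⟨a.isLt, b.isLt⟩, Matrix.of_apply]

/-- `entryN_Bfin_nat` (plumbing). [cite: KoiranPerifel2009VPSPACE, §3.2 (Uniform VPAR⁰: the syntax of a gate as a polynomial-time function of its name)] -/
theorem entryN_Bfin_nat {a b : ℕ} (ha : a < N2 Φ n + 2) (hb : b < N2 Φ n + 2) : entryN (Bfin Φ n) a b = bZ Φ n a b := by
  unfold entryN Bfin
  rw [dif_pos ⟨ha, hb⟩, Matrix.of_apply]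

/-- Decoding the digits of `u + M t + M² l`. [cite: MahajanVinay1999, §3.1] -/
theorem decode_arith (M l t u : ℕ) (hu : u < M) (ht : t < M) :
    (u + M * t + M * M * l) / (M * M) = l ∧ (u + M * t + M * M * l) / M % M = t ∧ (u + M * t + M * M * l) % M = u := by
  have hM : 0 < M := by omega
  refine ⟨?_, ?_, ?_⟩
  · rw [show u + M * t + M * M * l = (u + M * t) + (M * M) * l by ring, Nat.add_mul_div_left _ _ (by positivity),
      Nat.div_eq_of_lt (by nlinarith), zero_add]
  · rw [show u + M * t + M * M * l = u + M * (t + M * l) by ring, Nat.add_mul_div_left _ _ hM, Nat.div_eq_of_lt hu,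
      zero_add, Nat.add_mul_mod_self_left, Nat.mod_eq_of_lt ht]
  · rw [show u + M * t + M * M * l = u + M * (t + M * l) by ring, Nat.add_mul_mod_self_left, Nat.mod_eq_of_lt hu]

/-- The range of `u + M t + M² l` for `l ≤ M − 2`. [cite: MahajanVinay1999, §3.1] -/
theorem decode_bound (M l t u : ℕ) (hu : u < M) (ht : t < M) (hl : l + 2 ≤ M) :
    u + M * t + M * M * l + 1 ≤ (M - 1) * (M * M) := by
  obtain ⟨M', rfl⟩ : ∃ M', M = M' + 2 := ⟨M - 2, by omega⟩
  have h1 : u + (M' + 2) * t ≤ (M' + 2) * (M' + 2) - 1 := by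
    have := Nat.mul_le_mul_left (M' + 2) (show t ≤ M' + 1 by omega)
    have h' : (M' + 2) * (M' + 1) + (M' + 1) = (M' + 2) * (M' + 2) - 1 := by
      rw [show (M' + 2) * (M' + 2) = (M' + 2) * (M' + 1) + (M' + 1) + 1 by ring]; omega
    omega
  have h2 : (M' + 2) * (M' + 2) * l ≤ (M' + 2) * (M' + 2) * M' := Nat.mul_le_mul_left _ (by omega)
  have h3 : (M' + 2 - 1) * ((M' + 2) * (M' + 2)) = (M' + 2) * (M' + 2) * M' + (M' + 2) * (M' + 2) := by
    rw [show M' + 2 - 1 = M' + 1 by omega]; ring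
  have h4 : 1 ≤ (M' + 2) * (M' + 2) := by nlinarith
  omega

/-- Decoding an internal label. [cite: MahajanVinay1999, §3.1] -/
theorem mid_facts (hN : 2 ≤ Φ.N n) (l : Fin (N2 Φ n + 1)) (t u : Fin (N2 Φ n + 2)) :
    let y := 1 + ((u : ℕ) + (N2 Φ n + 2) * t + (N2 Φ n + 2) * (N2 Φ n + 2) * l)
    y ≠ 0 ∧ 0 < y ∧ y ≤ Φ.Lmid n ∧ (y - 1) / (Φ.N n * Φ.N n) = l ∧ (y - 1) / Φ.N n % Φ.N n = t ∧
      (y - 1) % Φ.N n = u ∧ y - (1 + Φ.Lmid n) = 0 := by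
  intro y
  have hNe := N2_add_two Φ hN
  have hy1 : y - 1 = (u : ℕ) + (N2 Φ n + 2) * t + (N2 Φ n + 2) * (N2 Φ n + 2) * l := by simp [y]
  have hLmid : Φ.Lmid n = (N2 Φ n + 1) * ((N2 Φ n + 2) * (N2 Φ n + 2)) := Lmid_eq Φ hN
  obtain ⟨d1, d2, d3⟩ := decode_arith (N2 Φ n + 2) l t u u.isLt t.isLt
  have hb := decode_bound (N2 Φ n + 2) l t u u.isLt t.isLt (by have := l.isLt; omega)
  rw [show N2 Φ n + 2 - 1 = N2 Φ n + 1 by omega] at hb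
  refine ⟨by omega, by omega, by omega, ?_, ?_, ?_, by omega⟩
  · rw [hy1, ← hNe]; exact d1
  · rw [hy1, ← hNe]; exact d2
  · rw [hy1, ← hNe]; exact d3

/-- Decoding a sink label. [cite: MahajanVinay1999, §3.1] -/
theorem snk_facts (hN : 2 ≤ Φ.N n) (d : Fin (N2 Φ n + 3)) :
    let y := 1 + ((N2 Φ n + 1) * ((N2 Φ n + 2) * (N2 Φ n + 2)) + d)
    y ≠ 0 ∧ ¬ (y ≤ Φ.Lmid n) ∧ y - (1 + Φ.Lmid n) = d := by
  intro y
  have hLmid := Lmid_eq Φ hN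
  refine ⟨by omega, by omega, by omega⟩

set_option maxHeartbeats 800000 in
/-- ★ **Label decoding is correct**: on labels of states, `mval` is the corresponding entry of
`mvCharAdj (AᵀA)`. [cite: MahajanVinay1999, Thm. 3.2 and §3.1 (p0005.txt:L20–27, p0006.txt:L11–47)] -/
theorem mval_labE (hN : 2 ≤ Φ.N n) (p q : CState (N2 Φ n)) :
    mval Φ n (labE Φ n p) (labE Φ n q) = mvCharAdj (Bfin Φ n) p q := by
  have hNe := N2_add_two Φ hN
  have hLmid := Lmid_eq Φ hN
  rcases q with ⟨⟨⟩⟩ | ⟨⟨l', t', u'⟩ | d'⟩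
  · -- into the source: nothing
    have h0 : (labE Φ n (Sum.inl PUnit.unit) : ℕ) = 0 := labE_src Φ n
    rw [h0, show (Sum.inl PUnit.unit : CState (N2 Φ n)) = CState.src (N2 Φ n) from rfl, mvCharAdj_apply_src]
    simp [mval, mKapL]
  · -- into an internal state
    obtain ⟨hy0, hypos, hyle, hyl, hyt, hyu, -⟩ := mid_facts Φ hN l' t' u'
    rw [show (Sum.inr (Sum.inl (l', t', u')) : CState (N2 Φ n)) = CState.mid (N2 Φ n) (l', (t', u')) from rfl, labE_mid]
    rcases p with ⟨⟨⟩⟩ | ⟨⟨l, t, u⟩ | d⟩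
    · -- from the source
      rw [show (Sum.inl PUnit.unit : CState (N2 Φ n)) = CState.src (N2 Φ n) from rfl, labE_src, mvCharAdj_src_mid,
        entryN_Bfin]
      simp only [mval, mKapL, mRowL, mColL, hy0, hypos, hyle, hyl, hyt, hyu, true_and, if_true, if_false, selW]
      split_ifs <;> (first | omega | contradiction)
    · -- from an internal state
      obtain ⟨hx0, hxpos, hxle, hxl, hxt, hxu, -⟩ := mid_facts Φ hN l t u
      rw [show (Sum.inr (Sum.inl (l, t, u)) : CState (N2 Φ n)) = CState.mid (N2 Φ n) (l, (t, u)) from rfl, labE_mid,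
        mvCharAdj_mid_mid]
      simp only [mval, mKapL, mRowL, mColL, hy0, hypos, hyle, hyl, hyt, hyu, hx0, hxpos, hxle, hxl, hxt, hxu,
        true_and, if_true, if_false, transN, selW]
      rw [entryN_Bfin_nat Φ u.isLt u'.isLt, entryN_Bfin_nat Φ t'.isLt u'.isLt]
      split_ifs <;> (first | omega | contradiction)
    · -- from a sink: nothing
      obtain ⟨hx0, hxle, -⟩ := snk_facts Φ hN d
      rw [show (Sum.inr (Sum.inr d) : CState (N2 Φ n)) = CState.snk (N2 Φ n) d from rfl, labE_snk, mvCharAdj_snk_mid]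
      simp only [mval, mKapL, hy0, hypos, hyle, hx0, hxle, if_true, if_false, and_self]
      simp
  · -- into a sink
    obtain ⟨hy0, hyle, hyd⟩ := snk_facts Φ hN d'
    rw [show (Sum.inr (Sum.inr d') : CState (N2 Φ n)) = CState.snk (N2 Φ n) d' from rfl, labE_snk]
    rcases p with ⟨⟨⟩⟩ | ⟨⟨l, t, u⟩ | d⟩
    · -- from the source: only `snk 0`
      rw [show (Sum.inl PUnit.unit : CState (N2 Φ n)) = CState.src (N2 Φ n) from rfl, labE_src, mvCharAdj_src_snk]
      simp only [mval, mKapL, mRowL, mColL, hy0, hyle, hyd, if_true, if_false, and_false]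
      split_ifs <;> (first | omega | contradiction)
    · -- from an internal state
      obtain ⟨hx0, hxpos, hxle, hxl, hxt, hxu, -⟩ := mid_facts Φ hN l t u
      rw [show (Sum.inr (Sum.inl (l, t, u)) : CState (N2 Φ n)) = CState.mid (N2 Φ n) (l, (t, u)) from rfl, labE_mid,
        mvCharAdj_mid_snk]
      simp only [mval, mKapL, mRowL, mColL, hy0, hyle, hyd, hx0, hxpos, hxle, hxl, hxt, hxu, true_and, if_true,
        if_false, and_false, transN, selW, lt_self_iff_false, Fin.ext_iff]
      have hd' := d'.isLt
      by_cases hdN : (d' : ℕ) = N2 Φ n + 2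
      · rw [if_pos hdN, if_pos (by omega : (d' : ℕ) = Φ.N n)]
        have e1 : Φ.N n - 2 = N2 Φ n := rfl
        have e2 : Φ.N n - 1 = N2 Φ n + 1 := by omega
        rw [e1, e2]
        by_cases hl : (l : ℕ) = N2 Φ n
        · rw [if_pos hl, if_pos hl]
          by_cases hut : (u : ℕ) < t
          · rw [if_pos hut, if_pos hut, if_pos hut]
            by_cases htN : (t : ℕ) = N2 Φ n + 1
            · rw [if_pos htN.symm, if_pos htN, entryN_Bfin_nat Φ u.isLt (by omega), ← htN]
              simp
            · rw [if_neg (Ne.symm htN), if_neg htN]; simp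
          · rw [if_neg hut, if_neg hut, if_neg hut]
            by_cases hue : (u : ℕ) = t
            · rw [if_pos hue, if_pos hue]
              by_cases htl : (t : ℕ) < N2 Φ n + 1
              · rw [if_pos htl, if_pos htl, entryN_Bfin_nat Φ (by omega) (by omega)]; simp
              · rw [if_neg htl, if_neg htl]; simp
            · rw [if_neg hue, if_neg hue]; simp
        · rw [if_neg hl, if_neg hl]; simp
      · rw [if_neg hdN, if_neg (by omega : ¬ (d' : ℕ) = Φ.N n)]
        split_ifs <;> (first | omega | contradiction)
    · -- from a sink: the self-loops
      obtain ⟨hx0, hxle, hxd⟩ := snk_facts Φ hN d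
      rw [show (Sum.inr (Sum.inr d) : CState (N2 Φ n)) = CState.snk (N2 Φ n) d from rfl, labE_snk, mvCharAdj_snk_snk]
      simp only [mval, mKapL, hy0, hyle, hyd, hx0, hxle, hxd, if_false, and_false, Fin.ext_iff]
      split_ifs <;> (first | omega | contradiction)

/-- ★ **`mZ = mval` on labels** (natural-number form). [cite: MahajanVinay1999, Thm. 3.2 and §3.1] -/
theorem mZ_eq_mval (hN : 2 ≤ Φ.N n) {x y : ℕ} (hx : x < Φ.X n) (hy : y < Φ.X n) : mZ Φ n x y = mval Φ n x y := by
  have hX := XL_eq Φ hN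
  have hx' : x < XL Φ n := hX ▸ hx
  have hy' : y < XL Φ n := hX ▸ hy
  obtain ⟨p, hp⟩ := (labE Φ n).surjective ⟨x, hx'⟩
  obtain ⟨q, hq⟩ := (labE Φ n).surjective ⟨y, hy'⟩
  have hpx : (labE Φ n p : ℕ) = x := by rw [hp]
  have hqy : (labE Φ n q : ℕ) = y := by rw [hq]
  have hm : mZ Φ n x y = Mhat Φ n (labE Φ n p) (labE Φ n q) := by
    unfold mZ; rw [dif_pos ⟨hx', hy'⟩]; exact congrArg₂ _ hp.symm hq.symm
  rw [hm, Mhat, Matrix.reindex_apply, Matrix.submatrix_apply, Equiv.symm_apply_apply, Equiv.symm_apply_apply,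
    ← mval_labE Φ hN, hpx, hqy]

end MGate


/-! ### Values of `M`, `P`, `C`: the matrix, its `2^t`-th powers, the coefficients of `χ_{AᵀA}` -/

section Powers
variable {n : ℕ}

/-- Well-formedness of the canonical tuples used below (all trailing fields `0`). [folklore] -/
private theorem wf_mk {c s f1 f2 f3 f4 : ℕ} (hN : 0 < Φ.N n) (hc : c ≤ 30) (hs : s ≤ 1) (h1 : f1 < Φ.FB n)
    (h2 : f2 < Φ.FB n) (h3 : f3 < Φ.FB n) (h4 : f4 < Φ.FB n)
    (ht : WFt Φ n c s f1 f2 f3 f4 0 0) : WF Φ n (Φ.Lreq n) [c, s, f1, f2, f3, f4, 0, 0] := by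
  have := Φ.FB_ge n
  simp only [WF, GWF, List.getD_cons_zero, List.getD_cons_succ]
  exact ⟨⟨hc, hs, h1, h2, h3, h4, by omega, by omega, le_rfl, hN⟩, ht⟩

/-- **`M(s,x,y)`**: arity `0` or `1` by decoding, the child being `ONE` or a `B` gate. [cite: MahajanVinay1999, §3.1; KoiranPerifel2009VPSPACE, §3.2] -/
theorem V_M (h : WF Φ n (Φ.Lreq n) [4, s, f1, f2, 0, 0, 0, 0]) :
    V Φ n 4 s f1 f2 0 0 0 0 =
      if mKapL Φ n f1 f2 = 1 then (if s = 0 then 1 else 0)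
      else if mKapL Φ n f1 f2 = 3 then V Φ n 2 s (mRowL Φ n f1 f2) (mColL Φ n f1 f2) 0 0 0 0
      else if mKapL Φ n f1 f2 = 4 then V Φ n 2 (1 - s) (mRowL Φ n f1 f2) (mColL Φ n f1 f2) 0 0 0 0
      else 0 := by
  obtain ⟨⟨-, hs, hb1, hb2, -, -, -, -, -, hNpos⟩, hr1, hr2⟩ := (wf_M Φ).1 h
  have hFB := Φ.FB_ge n
  have hk := K_kind Φ h; rw [kind_M Φ h] at hk
  have hrow := mRowL_lt Φ f1 f2 hNpos
  have hcol := mColL_lt Φ f1 f2 hNpos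
  have hNF : Φ.N n < Φ.FB n := by have := Φ.two_N_succ_le_FB n; omega
  unfold V
  rw [(kvc Φ).val_sum hk, K_arity Φ h, arity_M Φ h]
  simp only [K_child Φ h, child_M]
  by_cases h1 : mKapL Φ n f1 f2 = 1
  · simp only [h1, if_true, show (1:ℕ) ≠ 3 by norm_num, show (1:ℕ) ≠ 4 by norm_num, if_false]
    by_cases hs0 : s = 0
    · rw [if_pos hs0, sum_range_one]
      exact V_ONE Φ (s := 0) (f1 := 0) (f2 := 0) (f3 := 0) (f4 := 0) (f5 := 0) (f6 := 0)
        (wf_mk Φ hNpos (by norm_num) (by norm_num) (by omega) (by omega) (by omega) (by omega) trivial)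
    · rw [if_neg hs0, sum_range_zero]
  · simp only [h1, if_false]
    by_cases h3 : mKapL Φ n f1 f2 = 3
    · simp only [h3, if_true, sum_range_one]; rfl
    · simp only [h3, if_false]
      by_cases h4 : mKapL Φ n f1 f2 = 4
      · simp only [h4, if_true, sum_range_one]; rfl
      · simp only [h4, if_false, sum_range_zero]
set_option maxHeartbeats 400000 in -- buildfix (bf3-g31): 160k/180k FAIL, 200k PASS at accept time; line-neutral budget line
/-- ★ **`M⁺ − M⁻` is the reindexed all-coefficients matrix entry** `m̂(x, y)`. [cite: MahajanVinay1999, Thm. 3.2 and §3.1] -/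
theorem V_M_sub (hN : 2 ≤ Φ.N n) {x y : ℕ} (hx : x < Φ.X n) (hy : y < Φ.X n) :
    (V Φ n 4 0 x y 0 0 0 0 : ℤ) - V Φ n 4 1 x y 0 0 0 0 = mZ Φ n x y := by
  have hNpos : 0 < Φ.N n := by omega
  have hFB := Φ.FB_ge n
  have h2X := Φ.two_X_le_FB n
  have hw : ∀ s, s ≤ 1 → WF Φ n (Φ.Lreq n) [4, s, x, y, 0, 0, 0, 0] := fun s hs =>
    wf_mk Φ hNpos (by norm_num) hs (by omega) (by omega) (by omega) (by omega) ⟨hx, hy⟩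
  have hrow := mRowL_lt Φ x y hNpos
  have hcol := mColL_lt Φ x y hNpos
  rw [V_M Φ (hw 0 (by norm_num)), V_M Φ (hw 1 (by norm_num)), mZ_eq_mval Φ hN hx hy, mval]
  have hB := V_B_sub Φ hNpos hrow hcol
  by_cases h1 : mKapL Φ n x y = 1
  · simp [h1]
  · by_cases h3 : mKapL Φ n x y = 3
    · simp [h3]; linear_combination hB
    · by_cases h4 : mKapL Φ n x y = 4
      · simp [h4]; linear_combination -hB
      · simp [h1, h3, h4]

/-- Converting a sum over `range X` of the naturally-indexed entries to a matrix product entry. [folklore] -/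
private theorem sum_range_fin {X : ℕ} (f : ℕ → ℤ) (g : Fin X → ℤ) (hfg : ∀ i : Fin X, f i = g i) :
    ∑ z ∈ range X, f z = ∑ i : Fin X, g i := by
  rw [← Fin.sum_univ_eq_sum_range]
  exact Fintype.sum_congr _ _ hfg

/-- Powers of a reindexed matrix. [folklore] -/
private theorem reindex_pow {m k : Type*} [Fintype m] [DecidableEq m] [Fintype k] [DecidableEq k]
    (e : m ≃ k) (M : Matrix m m ℤ) (j : ℕ) : (Matrix.reindex e e M) ^ j = Matrix.reindex e e (M ^ j) := by
  rw [← Matrix.coe_reindexAlgEquiv ℤ ℤ e, map_pow]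

/-- `p 0 = m̂`. [cite: MahajanVinay1999, §3.1] -/
theorem pZ_zero (x y : ℕ) : pZ Φ n 0 x y = mZ Φ n x y := by
  unfold pZ mZ; simp only [pow_zero, pow_one]

/-- `p (t+1) x y = Σ_{z<X} p t x z · p t z y` (squaring). [cite: MahajanVinay1999, §3.1 (iterated products)] -/
theorem pZ_succ (hN : 2 ≤ Φ.N n) (t : ℕ) {x y : ℕ} (hx : x < Φ.X n) (hy : y < Φ.X n) :
    pZ Φ n (t + 1) x y = ∑ z ∈ range (Φ.X n), pZ Φ n t x z * pZ Φ n t z y := by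
  have hX := XL_eq Φ hN
  have hx' : x < XL Φ n := hX ▸ hx
  have hy' : y < XL Φ n := hX ▸ hy
  rw [← hX, sum_range_fin (fun z => pZ Φ n t x z * pZ Φ n t z y)
    (fun i => (Mhat Φ n ^ 2 ^ t) ⟨x, hx'⟩ i * (Mhat Φ n ^ 2 ^ t) i ⟨y, hy'⟩)
    (fun i => by unfold pZ; rw [dif_pos ⟨hx', i.isLt⟩, dif_pos ⟨i.isLt, hy'⟩])]
  unfold pZ
  rw [dif_pos ⟨hx', hy'⟩, pow_succ, pow_mul, sq, Matrix.mul_apply]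

/-- **`P(s,t,x,y)`**: for `t = 0` the `M` gate, for `t ≥ 1` the sum of the `2X` products `PP`. [cite: KoiranPerifel2009VPSPACE, §3.2, Prop. 1] -/
theorem V_P_zero (h : WF Φ n (Φ.Lreq n) [5, s, 0, f2, f3, 0, 0, 0]) : V Φ n 5 s 0 f2 f3 0 0 0 = V Φ n 4 s f2 f3 0 0 0 0 := by
  have hk := K_kind Φ h; rw [kind_P Φ h] at hk
  unfold V
  rw [(kvc Φ).val_sum hk, K_arity Φ h, arity_P Φ h]
  simp only [if_true, sum_range_one, K_child Φ h, child_P]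
  rfl

/-- `P` for `t ≥ 1`. [cite: KoiranPerifel2009VPSPACE, §3.2, Prop. 1] -/
theorem V_P_succ (t : ℕ) (h : WF Φ n (Φ.Lreq n) [5, s, t + 1, f2, f3, 0, 0, 0])
    (hPP : ∀ k, k < 2 * Φ.X n → WF Φ n (Φ.Lreq n) [6, s, t + 1, f2, f3, k, 0, 0]) :
    V Φ n 5 s (t + 1) f2 f3 0 0 0 =
      ∑ k ∈ range (2 * Φ.X n), V Φ n 5 (k % 2) t f2 (k / 2) 0 0 0 * V Φ n 5 ((k % 2 + s) % 2) t (k / 2) f3 0 0 0 := by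
  have hk := K_kind Φ h; rw [kind_P Φ h] at hk
  unfold V
  rw [(kvc Φ).val_sum hk, K_arity Φ h, arity_P Φ h]
  simp only [Nat.succ_ne_zero, if_false]
  refine sum_congr rfl fun k hk' => ?_
  have hkk := mem_range.1 hk'
  rw [K_child Φ h, child_P]
  simp only [Nat.succ_ne_zero, if_false]
  have hk2 := K_kind Φ (hPP k hkk); rw [kind_PP Φ (hPP k hkk)] at hk2
  rw [show gname (Φ.Lreq n) n [6, s, t + 1, f2, f3, k, 0, 0] = G Φ n 6 s (t + 1) f2 f3 k 0 0 from rfl,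
    (kvc Φ).val_mul hk2, K_child Φ (hPP k hkk), K_child Φ (hPP k hkk), child_PP_0, child_PP_1]
  simp only [Nat.add_sub_cancel]
  rfl

/-- ★ **`P⁺ − P⁻` is the `2^t`-th power of `m̂`.** [cite: MahajanVinay1999, §3.1 (iterated matrix products); KoiranPerifel2009VPSPACE, §3.2, Prop. 1] -/
theorem V_P_sub (hN : 2 ≤ Φ.N n) : ∀ (t : ℕ), t ≤ Φ.T n → ∀ {x y : ℕ}, x < Φ.X n → y < Φ.X n →
    (V Φ n 5 0 t x y 0 0 0 : ℤ) - V Φ n 5 1 t x y 0 0 0 = pZ Φ n t x y := by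
  have hNpos : 0 < Φ.N n := by omega
  obtain ⟨hFB, h2X, h2R, h2NN, h2N1, hXeq, hTF, hTFB, hLreq⟩ := Φ.param_facts n
  intro t
  induction t with
  | zero =>
    intro _ x y hx hy
    have hw : ∀ s, s ≤ 1 → WF Φ n (Φ.Lreq n) [5, s, 0, x, y, 0, 0, 0] := fun s hs =>
      wf_mk Φ hNpos (by norm_num) hs (by omega) (by omega) (by omega) (by omega) ⟨Nat.zero_le _, hx, hy⟩
    rw [V_P_zero Φ (hw 0 (by norm_num)), V_P_zero Φ (hw 1 (by norm_num)), pZ_zero]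
    exact V_M_sub Φ hN hx hy
  | succ t ih =>
    intro ht x y hx hy
    have hw : ∀ s, s ≤ 1 → WF Φ n (Φ.Lreq n) [5, s, t + 1, x, y, 0, 0, 0] := fun s hs =>
      wf_mk Φ hNpos (by norm_num) hs (by omega) (by omega) (by omega) (by omega) ⟨ht, hx, hy⟩
    have hPP : ∀ s k, s ≤ 1 → k < 2 * Φ.X n → WF Φ n (Φ.Lreq n) [6, s, t + 1, x, y, k, 0, 0] := fun s k hs hk =>
      wf_mk Φ hNpos (by norm_num) hs (by omega) (by omega) (by omega) (by omega) ⟨Nat.succ_pos _, ht, hx, hy, hk⟩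
    rw [V_P_succ Φ t (hw 0 (by norm_num)) (hPP 0 · (by norm_num)), V_P_succ Φ t (hw 1 (by norm_num)) (hPP 1 · (by norm_num)),
      pZ_succ Φ hN t hx hy]
    exact pairProd_sub (Φ.X n) (fun e z => V Φ n 5 e t x z 0 0 0) (fun e z => V Φ n 5 e t z y 0 0 0)
      (fun z => pZ Φ n t x z) (fun z => pZ Φ n t z y)
      (fun z hz => ih (by omega) hx hz) (fun z hz => ih (by omega) hz hy)

/-- The coefficients of the characteristic polynomial of `AᵀA`. [cite: MahajanVinay1999, Thm. 3.2 (the `c_i`)] -/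
def cZ (n i : ℕ) : ℤ := (Bfin Φ n).charpoly.coeff i

/-- **`C(s,i)`**: a copy of `P(s, T, src, snk (N − i))` for `i ≤ N`, else empty. [cite: MahajanVinay1999, Thm. 3.2] -/
theorem V_C (h : WF Φ n (Φ.Lreq n) [7, s, f1, 0, 0, 0, 0, 0]) :
    V Φ n 7 s f1 0 0 0 0 0 =
      if f1 ≤ Φ.N n then V Φ n 5 s (Φ.T n) 0 (1 + Φ.Lmid n + (Φ.N n - f1)) 0 0 0 else 0 := by
  have hk := K_kind Φ h; rw [kind_C Φ h] at hk
  unfold V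
  rw [(kvc Φ).val_sum hk, K_arity Φ h, arity_C Φ h]
  split_ifs with hi
  · rw [sum_range_one, K_child Φ h, child_C]; rfl
  · rw [sum_range_zero]

/-- ★ **`C⁺ − C⁻ = coeff χ_{AᵀA} i`** (via Mahajan–Vinay's one-matrix packaging of all coefficients and
`2^T ≥ N`). [cite: MahajanVinay1999, Thm. 3.2 (p0005.txt:L20–27); KoiranPerifel2009VPSPACE, §3.2, Prop. 1] -/
theorem V_C_sub (hN : 2 ≤ Φ.N n) {i : ℕ} (hi : i ≤ 2 * Φ.N n) :
    (V Φ n 7 0 i 0 0 0 0 0 : ℤ) - V Φ n 7 1 i 0 0 0 0 0 = cZ Φ n i := by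
  have hNpos : 0 < Φ.N n := by omega
  obtain ⟨hFB, h2X, h2R, h2NN, h2N1, hXeq, hTF, hTFB, hLreq⟩ := Φ.param_facts n
  have hNe := N2_add_two Φ hN
  have hw : ∀ s, s ≤ 1 → WF Φ n (Φ.Lreq n) [7, s, i, 0, 0, 0, 0, 0] := fun s hs =>
    wf_mk Φ hNpos (by norm_num) hs (by omega) (by omega) (by omega) (by omega) hi
  rw [V_C Φ (hw 0 (by norm_num)), V_C Φ (hw 1 (by norm_num))]
  by_cases hiN : i ≤ Φ.N n
  · rw [if_pos hiN, if_pos hiN]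
    have hlab : 1 + Φ.Lmid n + (Φ.N n - i) < Φ.X n := by omega
    have h0 : 0 < Φ.X n := by omega
    rw [V_P_sub Φ hN (Φ.T n) le_rfl h0 hlab]
    -- the power entry is the `(src, snk (N - i))` entry of `mvCharAdj (AᵀA) ^ 2^T`
    have hX := XL_eq Φ hN
    have hd : Φ.N n - i < N2 Φ n + 3 := by omega
    have hsrc : (labE Φ n (CState.src (N2 Φ n)) : ℕ) = 0 := labE_src Φ n
    have hsnk : (labE Φ n (CState.snk (N2 Φ n) ⟨Φ.N n - i, hd⟩) : ℕ) = 1 + Φ.Lmid n + (Φ.N n - i) := by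
      rw [labE_snk, Lmid_eq Φ hN]; simp only; ring
    unfold pZ
    rw [dif_pos ⟨by rw [hX]; exact h0, by rw [hX]; exact hlab⟩, Mhat, reindex_pow, Matrix.reindex_apply,
      Matrix.submatrix_apply]
    have e1 : (labE Φ n).symm ⟨0, by rw [hX]; exact h0⟩ = CState.src (N2 Φ n) := by
      apply (labE Φ n).injective; rw [Equiv.apply_symm_apply]; exact Fin.ext (by rw [hsrc])
    have e2 : (labE Φ n).symm ⟨1 + Φ.Lmid n + (Φ.N n - i), by rw [hX]; exact hlab⟩ =
        CState.snk (N2 Φ n) ⟨Φ.N n - i, hd⟩ := by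
      apply (labE Φ n).injective; rw [Equiv.apply_symm_apply]; exact Fin.ext (by rw [hsnk])
    rw [e1, e2, mvCharAdj_pow_src_snk (Bfin Φ n) (by rw [hNe]; exact (Φ.two_pow_T n).le), cZ]
    congr 1
    simp only
    omega
  · rw [if_neg hiN, if_neg hiN, cZ]
    simp only [Nat.cast_zero, sub_zero]
    symm
    apply Polynomial.coeff_eq_zero_of_natDegree_lt
    rw [Matrix.charpoly_natDegree_eq_dim, Fintype.card_fin]
    omega

end Powers


/-! ### Values of `BP`, `SQ`: binary powers of `AᵀA` -/

section BinPow
variable {n : ℕ}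

/-- The entries of `(AᵀA)^j` on natural indices (`0` off range). [cite: BorodinVonzurgathenHopcroft1982, §4 (powers of the matrix)] -/
def bpZ (n j a b : ℕ) : ℤ :=
  if h : a < N2 Φ n + 2 ∧ b < N2 Φ n + 2 then (Bfin Φ n ^ j) ⟨a, h.1⟩ ⟨b, h.2⟩ else 0

/-- `B^0 = 1`. [cite: BorodinVonzurgathenHopcroft1982, §4 (linear algebra of the characteristic polynomial)] -/
theorem bpZ_zero (hN : 2 ≤ Φ.N n) {a b : ℕ} (ha : a < Φ.N n) (hb : b < Φ.N n) :
    bpZ Φ n 0 a b = if a = b then 1 else 0 := by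
  have hNe := N2_add_two Φ hN
  unfold bpZ
  rw [dif_pos ⟨by omega, by omega⟩, pow_zero, Matrix.one_apply]
  simp only [Fin.mk.injEq]

/-- `B^(i+k) = B^i B^k`, entrywise over natural indices. [cite: BorodinVonzurgathenHopcroft1982, §4 (linear algebra of the characteristic polynomial)] -/
theorem bpZ_add (hN : 2 ≤ Φ.N n) (i k : ℕ) {a b : ℕ} (ha : a < Φ.N n) (hb : b < Φ.N n) :
    bpZ Φ n (i + k) a b = ∑ z ∈ range (Φ.N n), bpZ Φ n i a z * bpZ Φ n k z b := by
  have hNe := N2_add_two Φ hN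
  have ha' : a < N2 Φ n + 2 := by omega
  have hb' : b < N2 Φ n + 2 := by omega
  rw [← hNe, sum_range_fin (fun z => bpZ Φ n i a z * bpZ Φ n k z b)
    (fun z => (Bfin Φ n ^ i) ⟨a, ha'⟩ z * (Bfin Φ n ^ k) z ⟨b, hb'⟩)
    (fun z => by unfold bpZ; rw [dif_pos ⟨ha', z.isLt⟩, dif_pos ⟨z.isLt, hb'⟩])]
  unfold bpZ
  rw [dif_pos ⟨ha', hb'⟩, pow_add, Matrix.mul_apply]

/-- `B^1 = b`. [cite: BorodinVonzurgathenHopcroft1982, §4 (linear algebra of the characteristic polynomial)] -/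
theorem bpZ_one (hN : 2 ≤ Φ.N n) {a b : ℕ} (ha : a < Φ.N n) (hb : b < Φ.N n) : bpZ Φ n 1 a b = bZ Φ n a b := by
  have hNe := N2_add_two Φ hN
  unfold bpZ Bfin
  rw [dif_pos ⟨by omega, by omega⟩, pow_one, Matrix.of_apply]

/-- **`BP` at `j = 0`**: `[a = b ∧ s = 0]`. [cite: KoiranPerifel2009VPSPACE, §3.2, Prop. 1] -/
theorem V_BP_zero (h : WF Φ n (Φ.Lreq n) [8, s, 0, f2, f3, 0, 0, 0]) :
    V Φ n 8 s 0 f2 f3 0 0 0 = if f2 = f3 ∧ s = 0 then 1 else 0 := by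
  obtain ⟨⟨-, hs, -, hb2, hb3, -, -, -, -, hNpos⟩, -⟩ := (wf_BP Φ).1 h
  have hFB := Φ.FB_ge n
  have hk := K_kind Φ h; rw [kind_BP Φ h] at hk
  unfold V
  rw [(kvc Φ).val_sum hk, K_arity Φ h, arity_BP Φ h]
  simp only [if_true]
  split_ifs with hab
  · rw [sum_range_one, K_child Φ h, child_BP]
    simp only [if_true]
    exact V_ONE Φ (s := 0) (f1 := 0) (f2 := 0) (f3 := 0) (f4 := 0) (f5 := 0) (f6 := 0)
      (wf_mk Φ hNpos (by norm_num) (by norm_num) (by omega) (by omega) (by omega) (by omega) trivial)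
  · rw [sum_range_zero]

/-- **`BP` at even `j ≥ 2`**: a copy of `SQ`. [cite: KoiranPerifel2009VPSPACE, §3.2, Prop. 1] -/
theorem V_BP_even {j : ℕ} (hj : 0 < j) (hev : j % 2 = 0) (h : WF Φ n (Φ.Lreq n) [8, s, j, f2, f3, 0, 0, 0]) :
    V Φ n 8 s j f2 f3 0 0 0 = V Φ n 9 s j f2 f3 0 0 0 := by
  have hk := K_kind Φ h; rw [kind_BP Φ h] at hk
  have hne : j ≠ 0 := Nat.pos_iff_ne_zero.1 hj
  unfold V
  rw [(kvc Φ).val_sum hk, K_arity Φ h, arity_BP Φ h]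
  simp only [hne, if_false, hev, if_true, sum_range_one, K_child Φ h, child_BP]
  rfl

/-- **`BP` at odd `j`**: the sum of the `2N` products `PBP = SQ · B`. [cite: KoiranPerifel2009VPSPACE, §3.2, Prop. 1] -/
theorem V_BP_odd {j : ℕ} (hodd : j % 2 = 1) (h : WF Φ n (Φ.Lreq n) [8, s, j, f2, f3, 0, 0, 0])
    (hP : ∀ k, k < 2 * Φ.N n → WF Φ n (Φ.Lreq n) [11, s, j, f2, f3, k, 0, 0]) :
    V Φ n 8 s j f2 f3 0 0 0 =
      ∑ k ∈ range (2 * Φ.N n), V Φ n 9 (k % 2) j f2 (k / 2) 0 0 0 * V Φ n 2 ((k % 2 + s) % 2) (k / 2) f3 0 0 0 0 := by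
  have hk := K_kind Φ h; rw [kind_BP Φ h] at hk
  have hne : j ≠ 0 := by omega
  have hnev : ¬ j % 2 = 0 := by omega
  unfold V
  rw [(kvc Φ).val_sum hk, K_arity Φ h, arity_BP Φ h]
  simp only [hne, if_false, hnev]
  refine sum_congr rfl fun k hk' => ?_
  have hkk := mem_range.1 hk'
  rw [K_child Φ h, child_BP]
  simp only [hne, if_false, hnev]
  have hk2 := K_kind Φ (hP k hkk); rw [kind_PBP Φ (hP k hkk)] at hk2
  rw [show gname (Φ.Lreq n) n [11, s, j, f2, f3, k, 0, 0] = G Φ n 11 s j f2 f3 k 0 0 from rfl,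
    (kvc Φ).val_mul hk2, K_child Φ (hP k hkk), K_child Φ (hP k hkk), child_PBP_0, child_PBP_1]
  rfl

/-- **`SQ(s,j,a,b)`**: the sum of the `2N` products `PSQ = BP(j/2) · BP(j/2)`. [cite: KoiranPerifel2009VPSPACE, §3.2, Prop. 1] -/
theorem V_SQ (h : WF Φ n (Φ.Lreq n) [9, s, f1, f2, f3, 0, 0, 0])
    (hP : ∀ k, k < 2 * Φ.N n → WF Φ n (Φ.Lreq n) [10, s, f1, f2, f3, k, 0, 0]) :
    V Φ n 9 s f1 f2 f3 0 0 0 =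
      ∑ k ∈ range (2 * Φ.N n), V Φ n 8 (k % 2) (f1 / 2) f2 (k / 2) 0 0 0 * V Φ n 8 ((k % 2 + s) % 2) (f1 / 2) (k / 2) f3 0 0 0 := by
  have hk := K_kind Φ h; rw [kind_SQ Φ h] at hk
  unfold V
  rw [(kvc Φ).val_sum hk, K_arity Φ h, arity_SQ Φ h]
  refine sum_congr rfl fun k hk' => ?_
  have hkk := mem_range.1 hk'
  rw [K_child Φ h, child_SQ]
  have hk2 := K_kind Φ (hP k hkk); rw [kind_PSQ Φ (hP k hkk)] at hk2
  rw [show gname (Φ.Lreq n) n [10, s, f1, f2, f3, k, 0, 0] = G Φ n 10 s f1 f2 f3 k 0 0 from rfl,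
    (kvc Φ).val_mul hk2, K_child Φ (hP k hkk), K_child Φ (hP k hkk), child_PSQ_0, child_PSQ_1]
  rfl

/-- ★ **`BP⁺ − BP⁻ = (AᵀA)^j`** and **`SQ⁺ − SQ⁻ = (AᵀA)^{2⌊j/2⌋}`** (binary powering), by strong induction
on `j ≤ 2N`. [cite: BorodinVonzurgathenHopcroft1982, §4; KoiranPerifel2009VPSPACE, §3.2, Prop. 1] -/
theorem V_BP_sub (hN : 2 ≤ Φ.N n) : ∀ j : ℕ, j ≤ 2 * Φ.N n → ∀ {a b : ℕ}, a < Φ.N n → b < Φ.N n →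
    ((V Φ n 8 0 j a b 0 0 0 : ℤ) - V Φ n 8 1 j a b 0 0 0 = bpZ Φ n j a b) ∧
    (0 < j → (V Φ n 9 0 j a b 0 0 0 : ℤ) - V Φ n 9 1 j a b 0 0 0 = bpZ Φ n (2 * (j / 2)) a b) := by
  have hNpos : 0 < Φ.N n := by omega
  obtain ⟨hFB, h2X, h2R, h2NN, h2N1, hXeq, hTF, hTFB, hLreq⟩ := Φ.param_facts n
  intro j
  induction j using Nat.strong_induction_on with
  | _ j ih =>
    intro hj a b ha hb
    -- the square first (for `j ≥ 1`), from the induction hypothesis at `j / 2`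
    have hSQ : 0 < j → (V Φ n 9 0 j a b 0 0 0 : ℤ) - V Φ n 9 1 j a b 0 0 0 = bpZ Φ n (2 * (j / 2)) a b := by
      intro hjpos
      have hw : ∀ s, s ≤ 1 → WF Φ n (Φ.Lreq n) [9, s, j, a, b, 0, 0, 0] := fun s hs =>
        wf_mk Φ hNpos (by norm_num) hs (by omega) (by omega) (by omega) (by omega) ⟨hjpos, hj, ha, hb⟩
      have hP : ∀ s k, s ≤ 1 → k < 2 * Φ.N n → WF Φ n (Φ.Lreq n) [10, s, j, a, b, k, 0, 0] := fun s k hs hk =>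
        wf_mk Φ hNpos (by norm_num) hs (by omega) (by omega) (by omega) (by omega) ⟨hjpos, hj, ha, hb, hk⟩
      rw [V_SQ Φ (hw 0 (by norm_num)) (hP 0 · (by norm_num)), V_SQ Φ (hw 1 (by norm_num)) (hP 1 · (by norm_num)),
        show 2 * (j / 2) = j / 2 + j / 2 from two_mul _, bpZ_add Φ hN _ _ ha hb]
      exact pairProd_sub (Φ.N n) (fun e z => V Φ n 8 e (j / 2) a z 0 0 0) (fun e z => V Φ n 8 e (j / 2) z b 0 0 0)
        (fun z => bpZ Φ n (j / 2) a z) (fun z => bpZ Φ n (j / 2) z b)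
        (fun z hz => (ih (j / 2) (by omega) (by omega) ha hz).1) (fun z hz => (ih (j / 2) (by omega) (by omega) hz hb).1)
    refine ⟨?_, hSQ⟩
    have hw : ∀ s, s ≤ 1 → WF Φ n (Φ.Lreq n) [8, s, j, a, b, 0, 0, 0] := fun s hs =>
      wf_mk Φ hNpos (by norm_num) hs (by omega) (by omega) (by omega) (by omega) ⟨hj, ha, hb⟩
    rcases Nat.eq_zero_or_pos j with rfl | hjpos
    · rw [V_BP_zero Φ (hw 0 (by norm_num)), V_BP_zero Φ (hw 1 (by norm_num)), bpZ_zero Φ hN ha hb]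
      by_cases hab : a = b <;> simp [hab]
    · by_cases hev : j % 2 = 0
      · rw [V_BP_even Φ hjpos hev (hw 0 (by norm_num)), V_BP_even Φ hjpos hev (hw 1 (by norm_num)), hSQ hjpos]
        congr 1; omega
      · have hodd : j % 2 = 1 := by omega
        have hP : ∀ s k, s ≤ 1 → k < 2 * Φ.N n → WF Φ n (Φ.Lreq n) [11, s, j, a, b, k, 0, 0] := fun s k hs hk =>
          wf_mk Φ hNpos (by norm_num) hs (by omega) (by omega) (by omega) (by omega) ⟨hjpos, hj, hodd, ha, hb, hk⟩
        rw [V_BP_odd Φ hodd (hw 0 (by norm_num)) (hP 0 · (by norm_num)),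
          V_BP_odd Φ hodd (hw 1 (by norm_num)) (hP 1 · (by norm_num))]
        have hsplit : bpZ Φ n j a b = ∑ z ∈ range (Φ.N n), bpZ Φ n (2 * (j / 2)) a z * bZ Φ n z b := by
          conv_lhs => rw [show j = 2 * (j / 2) + 1 by omega]
          rw [bpZ_add Φ hN _ _ ha hb]
          exact sum_congr rfl fun z hz => by rw [bpZ_one Φ hN (mem_range.1 hz) hb]
        rw [hsplit]
        refine pairProd_sub (Φ.N n) (fun e z => V Φ n 9 e j a z 0 0 0) (fun e z => V Φ n 2 e z b 0 0 0 0)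
          (fun z => bpZ Φ n (2 * (j / 2)) a z) (fun z => bZ Φ n z b) (fun z hz => ?_) (fun z hz => V_B_sub Φ hNpos hz hb)
        -- the square at the same `j`, other column index
        have hw' : ∀ s, s ≤ 1 → WF Φ n (Φ.Lreq n) [9, s, j, a, z, 0, 0, 0] := fun s hs =>
          wf_mk Φ hNpos (by norm_num) hs (by omega) (by omega) (by omega) (by omega) ⟨hjpos, hj, ha, hz⟩
        have hP' : ∀ s k, s ≤ 1 → k < 2 * Φ.N n → WF Φ n (Φ.Lreq n) [10, s, j, a, z, k, 0, 0] := fun s k hs hk =>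
          wf_mk Φ hNpos (by norm_num) hs (by omega) (by omega) (by omega) (by omega) ⟨hjpos, hj, ha, hz, hk⟩
        rw [V_SQ Φ (hw' 0 (by norm_num)) (hP' 0 · (by norm_num)), V_SQ Φ (hw' 1 (by norm_num)) (hP' 1 · (by norm_num)),
          show 2 * (j / 2) = j / 2 + j / 2 from two_mul _, bpZ_add Φ hN _ _ ha hz]
        exact pairProd_sub (Φ.N n) (fun e w => V Φ n 8 e (j / 2) a w 0 0 0) (fun e w => V Φ n 8 e (j / 2) w z 0 0 0)
          (fun w => bpZ Φ n (j / 2) a w) (fun w => bpZ Φ n (j / 2) w z)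
          (fun w hw2 => (ih (j / 2) (by omega) (by omega) ha hw2).1)
          (fun w hw2 => (ih (j / 2) (by omega) (by omega) hw2 hz).1)

end BinPow


/-! ### Values of `CSQ`, `QK`, `QT`, `QB`: selecting `k_B` and `q_B(B)·B^j` -/

section QPart
variable {n : ℕ}

/-- `Σ_{i<K} c_i²`. [cite: BorodinVonzurgathenHopcroft1982, §4 (the order of `c(A)` at `0`)] -/
def csqZ (n K : ℕ) : ℤ := ∑ i ∈ range K, cZ Φ n i * cZ Φ n i

/-- `Σ_{i ≤ N} c_{i+k'} (AᵀA)^{i+j}`, entrywise. [cite: BorodinVonzurgathenHopcroft1982, §4] -/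
def qkZ (n k' j a b : ℕ) : ℤ := ∑ i ∈ range (Φ.N n + 1), cZ Φ n (i + k') * bpZ Φ n (i + j) a b

/-- `k_B`, the order of `χ_{AᵀA}` at `0`. [cite: BorodinVonzurgathenHopcroft1982, §4] -/
def kB (n : ℕ) : ℕ := charpolyZeroMult (Bfin Φ n)

/-- The matrix `q_B(B)·B^j`, `B = AᵀA`. [cite: BorodinVonzurgathenHopcroft1982, §4] -/
def QBmat (n j : ℕ) : Matrix (Fin (N2 Φ n + 2)) (Fin (N2 Φ n + 2)) ℤ :=
  Polynomial.aeval (Bfin Φ n) (charpolyUnitPart (Bfin Φ n)) * Bfin Φ n ^ j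

/-- Its entries on natural indices. [cite: BorodinVonzurgathenHopcroft1982, §4] -/
def qbZ (n j a b : ℕ) : ℤ := if h : a < N2 Φ n + 2 ∧ b < N2 Φ n + 2 then QBmat Φ n j ⟨a, h.1⟩ ⟨b, h.2⟩ else 0

/-- A sum of squares of integers vanishes iff every term does. [folklore] -/
private theorem sum_mul_self_eq_zero_iff {ι : Type*} (s : Finset ι) (f : ι → ℤ) :
    ∑ i ∈ s, f i * f i = 0 ↔ ∀ i ∈ s, f i = 0 := by
  rw [Finset.sum_eq_zero_iff_of_nonneg (fun i _ => mul_self_nonneg (f i))]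
  exact ⟨fun h i hi => mul_self_eq_zero.1 (h i hi), fun h i hi => by rw [h i hi, mul_zero]⟩

/-- `csq K = 0 ↔ c_0 = ⋯ = c_{K-1} = 0`. [cite: BorodinVonzurgathenHopcroft1982, §4] -/
theorem csqZ_eq_zero_iff (K : ℕ) : csqZ Φ n K = 0 ↔ ∀ i, i < K → cZ Φ n i = 0 := by
  unfold csqZ
  rw [sum_mul_self_eq_zero_iff]
  exact ⟨fun h i hi => h i (mem_range.2 hi), fun h i hi => h i (mem_range.1 hi)⟩

/-- **`k_B` is THE index with `c_0 = ⋯ = c_{k-1} = 0 ≠ c_k`.** [cite: BorodinVonzurgathenHopcroft1982, §4 (p0012:L46–66)] -/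
theorem kB_iff (k' : ℕ) : (csqZ Φ n k' = 0 ∧ cZ Φ n k' ≠ 0) ↔ k' = kB Φ n := by
  rw [csqZ_eq_zero_iff]
  have h1 : ∀ i, i < kB Φ n → cZ Φ n i = 0 := fun i hi => coeff_charpoly_eq_zero_of_lt (Bfin Φ n) hi
  have h2 : cZ Φ n (kB Φ n) ≠ 0 := coeff_charpoly_charpolyZeroMult_ne_zero (Bfin Φ n)
  constructor
  · rintro ⟨hz, hnz⟩
    rcases lt_trichotomy k' (kB Φ n) with h | h | h
    · exact absurd (h1 k' h) hnz
    · exact h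
    · exact absurd (hz _ h) h2
  · rintro rfl; exact ⟨h1, h2⟩

/-- `k_B ≤ N`. [cite: BorodinVonzurgathenHopcroft1982, §4] -/
theorem kB_le (hN : 2 ≤ Φ.N n) : kB Φ n ≤ Φ.N n := by
  unfold kB
  rw [charpolyZeroMult_eq_natTrailingDegree, ← N2_add_two Φ hN]
  calc (Bfin Φ n).charpoly.natTrailingDegree ≤ (Bfin Φ n).charpoly.natDegree := Polynomial.natTrailingDegree_le_natDegree _
    _ = N2 Φ n + 2 := by rw [Matrix.charpoly_natDegree_eq_dim, Fintype.card_fin]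

/-- **`qk k_B j = q_B(B)·B^j`** (`q_B(B) = Σ_{i≤N} c_{i+k_B} B^i`). [cite: BorodinVonzurgathenHopcroft1982, §4 (p0012:L46–66)] -/
theorem qkZ_kB (hN : 2 ≤ Φ.N n) (j : ℕ) {a b : ℕ} (ha : a < Φ.N n) (hb : b < Φ.N n) :
    qkZ Φ n (kB Φ n) j a b = qbZ Φ n j a b := by
  have hNe := N2_add_two Φ hN
  have ha' : a < N2 Φ n + 2 := by omega
  have hb' : b < N2 Φ n + 2 := by omega
  unfold qbZ QBmat qkZ
  rw [← hNe, dif_pos ⟨ha', hb'⟩, aeval_charpolyUnitPart_eq_sum, Fintype.card_fin, Finset.sum_mul, Matrix.sum_apply]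
  refine sum_congr rfl fun i _ => ?_
  rw [Matrix.smul_mul, Matrix.smul_apply, ← pow_add, smul_eq_mul]
  unfold cZ bpZ kB
  rw [dif_pos ⟨ha', hb'⟩]

/-- **`CSQ(s,K)`**: the sum of the `2K` products `PC = C·C`. [cite: KoiranPerifel2009VPSPACE, §3.2, Prop. 1] -/
theorem V_CSQ (h : WF Φ n (Φ.Lreq n) [12, s, f1, 0, 0, 0, 0, 0])
    (hP : ∀ k, k < 2 * f1 → WF Φ n (Φ.Lreq n) [13, s, k, 0, 0, 0, 0, 0]) :
    V Φ n 12 s f1 0 0 0 0 0 =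
      ∑ k ∈ range (2 * f1), V Φ n 7 (k % 2) (k / 2) 0 0 0 0 0 * V Φ n 7 ((k % 2 + s) % 2) (k / 2) 0 0 0 0 0 := by
  have hk := K_kind Φ h; rw [kind_CSQ Φ h] at hk
  unfold V
  rw [(kvc Φ).val_sum hk, K_arity Φ h, arity_CSQ Φ h]
  refine sum_congr rfl fun k hk' => ?_
  have hkk := mem_range.1 hk'
  rw [K_child Φ h, child_CSQ]
  have hk2 := K_kind Φ (hP k hkk); rw [kind_PC Φ (hP k hkk)] at hk2
  rw [show gname (Φ.Lreq n) n [13, s, k, 0, 0, 0, 0, 0] = G Φ n 13 s k 0 0 0 0 0 from rfl,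
    (kvc Φ).val_mul hk2, K_child Φ (hP k hkk), K_child Φ (hP k hkk), child_PC_0, child_PC_1]
  rfl

/-- ★ `CSQ⁺ − CSQ⁻ = Σ_{i<K} c_i²`. [cite: BorodinVonzurgathenHopcroft1982, §4; KoiranPerifel2009VPSPACE, §3.2] -/
theorem V_CSQ_sub (hN : 2 ≤ Φ.N n) {K : ℕ} (hK : K ≤ Φ.N n + 1) :
    (V Φ n 12 0 K 0 0 0 0 0 : ℤ) - V Φ n 12 1 K 0 0 0 0 0 = csqZ Φ n K := by
  have hNpos : 0 < Φ.N n := by omega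
  obtain ⟨hFB, h2X, h2R, h2NN, h2N1, hXeq, hTF, hTFB, hLreq⟩ := Φ.param_facts n
  have hw : ∀ s, s ≤ 1 → WF Φ n (Φ.Lreq n) [12, s, K, 0, 0, 0, 0, 0] := fun s hs =>
    wf_mk Φ hNpos (by norm_num) hs (by omega) (by omega) (by omega) (by omega) hK
  have hP : ∀ s k, s ≤ 1 → k < 2 * K → WF Φ n (Φ.Lreq n) [13, s, k, 0, 0, 0, 0, 0] := fun s k hs hk =>
    wf_mk Φ hNpos (by norm_num) hs (by omega) (by omega) (by omega) (by omega) (by omega : k < 2 * (Φ.N n + 1))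
  rw [V_CSQ Φ (hw 0 (by norm_num)) (hP 0 · (by norm_num)), V_CSQ Φ (hw 1 (by norm_num)) (hP 1 · (by norm_num)), csqZ]
  exact pairProd_sub K (fun e i => V Φ n 7 e i 0 0 0 0 0) (fun e i => V Φ n 7 e i 0 0 0 0 0) (cZ Φ n) (cZ Φ n)
    (fun i hi => V_C_sub Φ hN (by omega)) (fun i hi => V_C_sub Φ hN (by omega))

/-- **`QK(s,k',j,a,b)`**: the sum of the `2(N+1)` products `PQK = C(i+k')·BP(i+j)`. [cite: KoiranPerifel2009VPSPACE, §3.2, Prop. 1] -/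
theorem V_QK (h : WF Φ n (Φ.Lreq n) [14, s, f1, f2, f3, f4, 0, 0])
    (hP : ∀ k, k < 2 * (Φ.N n + 1) → WF Φ n (Φ.Lreq n) [15, s, f1, f2, f3, f4, k, 0]) :
    V Φ n 14 s f1 f2 f3 f4 0 0 =
      ∑ k ∈ range (2 * (Φ.N n + 1)),
        V Φ n 7 (k % 2) (k / 2 + f1) 0 0 0 0 0 * V Φ n 8 ((k % 2 + s) % 2) (k / 2 + f2) f3 f4 0 0 0 := by
  have hk := K_kind Φ h; rw [kind_QK Φ h] at hk
  unfold V
  rw [(kvc Φ).val_sum hk, K_arity Φ h, arity_QK Φ h]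
  refine sum_congr rfl fun k hk' => ?_
  have hkk := mem_range.1 hk'
  rw [K_child Φ h, child_QK]
  have hw2 := hP k hkk
  have hfit : (gcore n [15, s, f1, f2, f3, f4, k, 0]).length ≤ Φ.Lreq n := by
    have h1 := hw2.1
    simp only [GWF, List.getD_cons_zero, List.getD_cons_succ] at h1
    obtain ⟨h30, hs, hb1, hb2, hb3, hb4, hb5, hb6, -, -⟩ := h1
    have := Φ.FB_ge n
    exact fits8 Φ (by omega) (by omega) hb1 hb2 hb3 hb4 hb5 hb6 le_rfl
  have hk2 : (kvc Φ).kind (gname (Φ.Lreq n) n [15, s, f1, f2, f3, f4, k, 0]) = 2 := by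
    rw [kvc_kind, geval_gname' (m := 8) _ rfl hfit, kind_PQK Φ hw2]
  rw [(kvc Φ).val_mul hk2, kvc_child, kvc_child, gchild_gname' (m := 8) _ rfl hfit, gchild_gname' (m := 8) _ rfl hfit,
    child_PQK_0, child_PQK_1]
  rfl

/-- ★ `QK⁺ − QK⁻ = Σ_{i≤N} c_{i+k'}·((AᵀA)^{i+j}) a b`. [cite: BorodinVonzurgathenHopcroft1982, §4; KoiranPerifel2009VPSPACE, §3.2] -/
theorem V_QK_sub (hN : 2 ≤ Φ.N n) {k' j a b : ℕ} (hk' : k' ≤ Φ.N n) (hj : j ≤ Φ.N n) (ha : a < Φ.N n)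
    (hb : b < Φ.N n) : (V Φ n 14 0 k' j a b 0 0 : ℤ) - V Φ n 14 1 k' j a b 0 0 = qkZ Φ n k' j a b := by
  have hNpos : 0 < Φ.N n := by omega
  obtain ⟨hFB, h2X, h2R, h2NN, h2N1, hXeq, hTF, hTFB, hLreq⟩ := Φ.param_facts n
  have hw : ∀ s, s ≤ 1 → WF Φ n (Φ.Lreq n) [14, s, k', j, a, b, 0, 0] := fun s hs =>
    wf_mk Φ hNpos (by norm_num) hs (by omega) (by omega) (by omega) (by omega) ⟨hk', hj, ha, hb⟩
  have hP : ∀ s k, s ≤ 1 → k < 2 * (Φ.N n + 1) → WF Φ n (Φ.Lreq n) [15, s, k', j, a, b, k, 0] := by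
    intro s k hs hk
    have := Φ.FB_ge n
    simp only [WF, GWF, WFt, List.getD_cons_zero, List.getD_cons_succ]
    exact ⟨⟨by norm_num, hs, by omega, by omega, by omega, by omega, by omega, by omega, le_rfl, hNpos⟩,
      hk', hj, ha, hb, hk⟩
  rw [V_QK Φ (hw 0 (by norm_num)) (hP 0 · (by norm_num)), V_QK Φ (hw 1 (by norm_num)) (hP 1 · (by norm_num)), qkZ]
  exact pairProd_sub (Φ.N n + 1) (fun e i => V Φ n 7 e (i + k') 0 0 0 0 0) (fun e i => V Φ n 8 e (i + j) a b 0 0 0)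
    (fun i => cZ Φ n (i + k')) (fun i => bpZ Φ n (i + j) a b)
    (fun i hi => V_C_sub Φ hN (by omega)) (fun i hi => (V_BP_sub Φ hN (i + j) (by omega) ha hb).1)

/-- Two naturals with integer difference `d` are equal iff `d = 0`. [folklore] -/
private theorem nat_eq_iff_sub_eq_zero {p q : ℕ} {d : ℤ} (h : (p : ℤ) - q = d) : p = q ↔ d = 0 := by
  constructor
  · rintro rfl; rw [← h, sub_self]
  · intro hd; rw [hd, sub_eq_zero] at h; exact_mod_cast h

/-- **`QT2(s,k',j,a,b)`**: `[c_{k'} ≠ 0]·QK`. [cite: KoiranPerifel2009VPSPACE, §3.2 (select gates)] -/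
theorem V_QT2 (hN : 2 ≤ Φ.N n) {s k' j a b : ℕ} (hs : s ≤ 1) (hk' : k' ≤ Φ.N n) (hj : j ≤ Φ.N n) (ha : a < Φ.N n)
    (hb : b < Φ.N n) :
    V Φ n 17 s k' j a b 0 0 = if cZ Φ n k' = 0 then 0 else V Φ n 14 s k' j a b 0 0 := by
  have hNpos : 0 < Φ.N n := by omega
  obtain ⟨hFB, h2X, h2R, h2NN, h2N1, hXeq, hTF, hTFB, hLreq⟩ := Φ.param_facts n
  have h : WF Φ n (Φ.Lreq n) [17, s, k', j, a, b, 0, 0] :=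
    wf_mk Φ hNpos (by norm_num) hs (by omega) (by omega) (by omega) (by omega) ⟨hk', hj, ha, hb⟩
  have hC : ∀ e, e ≤ 1 → WF Φ n (Φ.Lreq n) [7, e, k', 0, 0, 0, 0, 0] := fun e he =>
    wf_mk Φ hNpos (by norm_num) he (by omega) (by omega) (by omega) (by omega) (by omega : k' ≤ 2 * Φ.N n)
  have hZ : WF Φ n (Φ.Lreq n) [30, 0, 0, 0, 0, 0, 0, 0] :=
    wf_mk Φ hNpos (by norm_num) (by norm_num) (by omega) (by omega) (by omega) (by omega) trivial
  have hk := K_kind Φ h; rw [kind_QT2 Φ h] at hk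
  unfold V
  rw [(kvc Φ).val_mux hk, K_width Φ h, width_QT2 Φ h]
  simp only [K_child Φ h, child_QT2_0, child_QT2_1, child_QT2_2, child_QT2_3]
  change (if V Φ n 7 0 k' 0 0 0 0 0 % 2 ^ Φ.Wmux n = V Φ n 7 1 k' 0 0 0 0 0 % 2 ^ Φ.Wmux n then V Φ n 30 0 0 0 0 0 0 0
    else V Φ n 14 s k' j a b 0 0) = _
  rw [V_mod Φ (hC 0 (by norm_num)), V_mod Φ (hC 1 (by norm_num)), V_ZERO Φ hZ]
  have hiff := nat_eq_iff_sub_eq_zero (V_C_sub Φ hN (i := k') (by omega))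
  by_cases hc : cZ Φ n k' = 0
  · rw [if_pos (hiff.2 hc), if_pos hc]
  · rw [if_neg (mt hiff.1 hc), if_neg hc]; rfl

/-- **`QT(s,k',j,a,b)`**: `[c_0 = ⋯ = c_{k'-1} = 0]·QT2`. [cite: KoiranPerifel2009VPSPACE, §3.2 (select gates)] -/
theorem V_QT (hN : 2 ≤ Φ.N n) {s k' j a b : ℕ} (hs : s ≤ 1) (hk' : k' ≤ Φ.N n) (hj : j ≤ Φ.N n) (ha : a < Φ.N n)
    (hb : b < Φ.N n) :
    V Φ n 16 s k' j a b 0 0 = if csqZ Φ n k' = 0 then V Φ n 17 s k' j a b 0 0 else 0 := by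
  have hNpos : 0 < Φ.N n := by omega
  obtain ⟨hFB, h2X, h2R, h2NN, h2N1, hXeq, hTF, hTFB, hLreq⟩ := Φ.param_facts n
  have h : WF Φ n (Φ.Lreq n) [16, s, k', j, a, b, 0, 0] :=
    wf_mk Φ hNpos (by norm_num) hs (by omega) (by omega) (by omega) (by omega) ⟨hk', hj, ha, hb⟩
  have hC : ∀ e, e ≤ 1 → WF Φ n (Φ.Lreq n) [12, e, k', 0, 0, 0, 0, 0] := fun e he =>
    wf_mk Φ hNpos (by norm_num) he (by omega) (by omega) (by omega) (by omega) (by omega : k' ≤ Φ.N n + 1)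
  have hZ : WF Φ n (Φ.Lreq n) [30, 0, 0, 0, 0, 0, 0, 0] :=
    wf_mk Φ hNpos (by norm_num) (by norm_num) (by omega) (by omega) (by omega) (by omega) trivial
  have hk := K_kind Φ h; rw [kind_QT Φ h] at hk
  unfold V
  rw [(kvc Φ).val_mux hk, K_width Φ h, width_QT Φ h]
  simp only [K_child Φ h, child_QT_0, child_QT_1, child_QT_2, child_QT_3]
  change (if V Φ n 12 0 k' 0 0 0 0 0 % 2 ^ Φ.Wmux n = V Φ n 12 1 k' 0 0 0 0 0 % 2 ^ Φ.Wmux n then V Φ n 17 s k' j a b 0 0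
    else V Φ n 30 0 0 0 0 0 0 0) = _
  rw [V_mod Φ (hC 0 (by norm_num)), V_mod Φ (hC 1 (by norm_num)), V_ZERO Φ hZ]
  have hiff := nat_eq_iff_sub_eq_zero (V_CSQ_sub Φ hN (K := k') (by omega))
  by_cases hc : csqZ Φ n k' = 0
  · rw [if_pos (hiff.2 hc), if_pos hc]; rfl
  · rw [if_neg (mt hiff.1 hc), if_neg hc]

/-- `QT⁺ − QT⁻ = [c_0 = ⋯ = c_{k'-1} = 0 ≠ c_{k'}]·qk k' j`. [cite: BorodinVonzurgathenHopcroft1982, §4; KoiranPerifel2009VPSPACE, §3.2] -/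
theorem V_QT_sub (hN : 2 ≤ Φ.N n) {k' j a b : ℕ} (hk' : k' ≤ Φ.N n) (hj : j ≤ Φ.N n) (ha : a < Φ.N n)
    (hb : b < Φ.N n) :
    (V Φ n 16 0 k' j a b 0 0 : ℤ) - V Φ n 16 1 k' j a b 0 0 =
      if csqZ Φ n k' = 0 ∧ cZ Φ n k' ≠ 0 then qkZ Φ n k' j a b else 0 := by
  rw [V_QT Φ hN (by norm_num) hk' hj ha hb, V_QT Φ hN (by norm_num) hk' hj ha hb,
    V_QT2 Φ hN (by norm_num) hk' hj ha hb, V_QT2 Φ hN (by norm_num) hk' hj ha hb, ← V_QK_sub Φ hN hk' hj ha hb]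
  by_cases h1 : csqZ Φ n k' = 0 <;> by_cases h2 : cZ Φ n k' = 0 <;> simp [h1, h2]

/-- **`QB(s,j,a,b)`**: the sum of the `N+1` selects `QT(s,k',j,a,b)`. [cite: KoiranPerifel2009VPSPACE, §3.2, Prop. 1] -/
theorem V_QB (h : WF Φ n (Φ.Lreq n) [18, s, f1, f2, f3, 0, 0, 0]) :
    V Φ n 18 s f1 f2 f3 0 0 0 = ∑ k' ∈ range (Φ.N n + 1), V Φ n 16 s k' f1 f2 f3 0 0 := by
  have hk := K_kind Φ h; rw [kind_QB Φ h] at hk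
  unfold V
  rw [(kvc Φ).val_sum hk, K_arity Φ h, arity_QB Φ h]
  refine sum_congr rfl fun k _ => ?_
  rw [K_child Φ h, child_QB]; rfl

/-- ★ **`QB⁺ − QB⁻ = (q_B(B)·B^j) a b`**: exactly the summand `k' = k_B` survives the selects.
[cite: BorodinVonzurgathenHopcroft1982, §4 (p0012:L46–66: the order of `c(A)` at `0`); KoiranPerifel2009VPSPACE, §3.2] -/
theorem V_QB_sub (hN : 2 ≤ Φ.N n) {j a b : ℕ} (hj : j ≤ Φ.N n) (ha : a < Φ.N n) (hb : b < Φ.N n) :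
    (V Φ n 18 0 j a b 0 0 0 : ℤ) - V Φ n 18 1 j a b 0 0 0 = qbZ Φ n j a b := by
  have hNpos : 0 < Φ.N n := by omega
  obtain ⟨hFB, h2X, h2R, h2NN, h2N1, hXeq, hTF, hTFB, hLreq⟩ := Φ.param_facts n
  have hw : ∀ s, s ≤ 1 → WF Φ n (Φ.Lreq n) [18, s, j, a, b, 0, 0, 0] := fun s hs =>
    wf_mk Φ hNpos (by norm_num) hs (by omega) (by omega) (by omega) (by omega) ⟨hj, ha, hb⟩
  rw [V_QB Φ (hw 0 (by norm_num)), V_QB Φ (hw 1 (by norm_num)),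
    pairSum_sub (Φ.N n + 1) (fun e k' => V Φ n 16 e k' j a b 0 0)
      (fun k' => if csqZ Φ n k' = 0 ∧ cZ Φ n k' ≠ 0 then qkZ Φ n k' j a b else 0)
      (fun k' hk' => V_QT_sub Φ hN (by omega) hj ha hb)]
  rw [sum_congr rfl (fun k' _ => show (if csqZ Φ n k' = 0 ∧ cZ Φ n k' ≠ 0 then qkZ Φ n k' j a b else 0) =
      (if k' = kB Φ n then qkZ Φ n k' j a b else 0) by
        by_cases h : k' = kB Φ n
        · rw [if_pos h, if_pos ((kB_iff Φ k').2 h)]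
        · rw [if_neg h, if_neg (mt (kB_iff Φ k').1 h)]),
    Finset.sum_ite_eq', if_pos (mem_range.2 (Nat.lt_succ_of_le (kB_le Φ hN)))]
  exact qkZ_kB Φ hN j ha hb

end QPart


/-! ### Values of `QSQ`, `NT`, `NB`: selecting `j₀` and the kernel matrix `N_B` -/

section NPart
variable {n : ℕ}

/-- `Σ_{a,b<N} (q_B(B)B^j)_{ab}²`, indexed by `w = N a + b`. [cite: BorodinVonzurgathenHopcroft1982, §4] -/
def qsqZ (n j : ℕ) : ℤ :=
  ∑ w ∈ range (Φ.N n * Φ.N n), qbZ Φ n j (w / Φ.N n) (w % Φ.N n) * qbZ Φ n j (w / Φ.N n) (w % Φ.N n)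

/-- `j₀`. [cite: BorodinVonzurgathenHopcroft1982, §4] -/
def j0 (n : ℕ) : ℕ := charpolyNilIndex (Bfin Φ n)

/-- The entries of the kernel matrix `N_B = q_B(B)·B^{j₀−1}` on natural indices. [cite: BorodinVonzurgathenHopcroft1982, §5 (NULLSPACE)] -/
def nbZ (n a b : ℕ) : ℤ :=
  if h : a < N2 Φ n + 2 ∧ b < N2 Φ n + 2 then charpolyKernelMatrix (Bfin Φ n) ⟨a, h.1⟩ ⟨b, h.2⟩ else 0

/-- `qsq j = 0 ↔ q_B(B)·B^j = 0`. [cite: BorodinVonzurgathenHopcroft1982, §4] -/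
theorem qsqZ_eq_zero_iff (hN : 2 ≤ Φ.N n) (j : ℕ) : qsqZ Φ n j = 0 ↔ QBmat Φ n j = 0 := by
  have hNe := N2_add_two Φ hN
  have hNpos : 0 < Φ.N n := by omega
  unfold qsqZ
  rw [sum_mul_self_eq_zero_iff]
  constructor
  · intro h
    ext a b
    have ha := a.isLt; have hb := b.isLt
    have hw : Φ.N n * a + b < Φ.N n * Φ.N n := by rw [← hNe] at *; nlinarith
    have h1 := h (Φ.N n * a + b) (mem_range.2 hw)
    rw [Nat.mul_add_div hNpos, Nat.div_eq_of_lt (by omega), add_zero, Nat.mul_add_mod,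
      Nat.mod_eq_of_lt (by omega)] at h1
    unfold qbZ at h1
    rw [dif_pos ⟨a.isLt, b.isLt⟩] at h1
    exact h1
  · intro h w hw
    have hw' := mem_range.1 hw
    have h1 : w / Φ.N n < N2 Φ n + 2 := by rw [hNe]; exact Nat.div_lt_of_lt_mul hw'
    have h2 : w % Φ.N n < N2 Φ n + 2 := by rw [hNe]; exact Nat.mod_lt _ hNpos
    unfold qbZ
    rw [dif_pos ⟨h1, h2⟩, h]
    rfl

/-- **`j₀` is THE index with `q_B(B)B^{j'+1} = 0 ≠ q_B(B)B^{j'}`, shifted by one.** [cite: BorodinVonzurgathenHopcroft1982, §4 (p0012:L46–66)] -/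
theorem j0_iff (j' : ℕ) : (QBmat Φ n (j' + 1) = 0 ∧ QBmat Φ n j' ≠ 0) ↔ j' + 1 = j0 Φ n := by
  unfold QBmat j0
  constructor
  · rintro ⟨hz, hnz⟩
    have h1 : j' < charpolyNilIndex (Bfin Φ n) := by
      by_contra hle
      have hle := not_lt.1 hle
      apply hnz
      obtain ⟨d, hd⟩ := Nat.exists_eq_add_of_le hle
      rw [hd, pow_add, ← Matrix.mul_assoc, charpolyNilIndex_spec, Matrix.zero_mul]
    have h2 : ¬ j' + 1 < charpolyNilIndex (Bfin Φ n) := fun hlt => charpolyNilIndex_min (Bfin Φ n) hlt hz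
    omega
  · intro h
    refine ⟨?_, charpolyNilIndex_min (Bfin Φ n) (by omega)⟩
    rw [h]; exact charpolyNilIndex_spec (Bfin Φ n)

/-- `j₀ ≤ N`. [cite: BorodinVonzurgathenHopcroft1982, §4] -/
theorem j0_le (hN : 2 ≤ Φ.N n) : j0 Φ n ≤ Φ.N n :=
  (charpolyNilIndex_le (Bfin Φ n)).trans (kB_le Φ hN)

/-- `N_B = q_B(B)·B^{j₀−1}` entrywise; `= 0` if `j₀ = 0`. [cite: BorodinVonzurgathenHopcroft1982, §5 (NULLSPACE)] -/
theorem nbZ_eq (hN : 2 ≤ Φ.N n) {a b : ℕ} (ha : a < Φ.N n) (hb : b < Φ.N n) :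
    nbZ Φ n a b = if 0 < j0 Φ n then qbZ Φ n (j0 Φ n - 1) a b else 0 := by
  have hNe := N2_add_two Φ hN
  have ha' : a < N2 Φ n + 2 := by omega
  have hb' : b < N2 Φ n + 2 := by omega
  unfold nbZ qbZ QBmat charpolyKernelMatrix
  rw [dif_pos ⟨ha', hb'⟩, dif_pos ⟨ha', hb'⟩]
  split_ifs with hj
  · rfl
  · have hj0 : charpolyNilIndex (Bfin Φ n) = 0 := by unfold j0 at hj; omega
    have hq : Polynomial.aeval (Bfin Φ n) (charpolyUnitPart (Bfin Φ n)) = 0 := by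
      have := charpolyNilIndex_spec (Bfin Φ n); rwa [hj0, pow_zero, Matrix.mul_one] at this
    rw [hq, Matrix.zero_mul]; rfl

/-- **`QSQ(s,j)`**: the sum of the `2N²` products `PQ = QB·QB`. [cite: KoiranPerifel2009VPSPACE, §3.2, Prop. 1] -/
theorem V_QSQ (h : WF Φ n (Φ.Lreq n) [19, s, f1, 0, 0, 0, 0, 0])
    (hP : ∀ k, k < 2 * (Φ.N n * Φ.N n) → WF Φ n (Φ.Lreq n) [20, s, f1, k, 0, 0, 0, 0]) :
    V Φ n 19 s f1 0 0 0 0 0 =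
      ∑ k ∈ range (2 * (Φ.N n * Φ.N n)),
        V Φ n 18 (k % 2) f1 (k / 2 / Φ.N n) (k / 2 % Φ.N n) 0 0 0 *
          V Φ n 18 ((k % 2 + s) % 2) f1 (k / 2 / Φ.N n) (k / 2 % Φ.N n) 0 0 0 := by
  have hk := K_kind Φ h; rw [kind_QSQ Φ h] at hk
  unfold V
  rw [(kvc Φ).val_sum hk, K_arity Φ h, arity_QSQ Φ h]
  refine sum_congr rfl fun k hk' => ?_
  have hkk := mem_range.1 hk'
  rw [K_child Φ h, child_QSQ]
  have hk2 := K_kind Φ (hP k hkk); rw [kind_PQ Φ (hP k hkk)] at hk2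
  rw [show gname (Φ.Lreq n) n [20, s, f1, k, 0, 0, 0, 0] = G Φ n 20 s f1 k 0 0 0 0 from rfl,
    (kvc Φ).val_mul hk2, K_child Φ (hP k hkk), K_child Φ (hP k hkk), child_PQ_0, child_PQ_1]
  rfl

/-- ★ `QSQ⁺ − QSQ⁻ = Σ (q_B(B)B^j)_{ab}²`. [cite: BorodinVonzurgathenHopcroft1982, §4; KoiranPerifel2009VPSPACE, §3.2] -/
theorem V_QSQ_sub (hN : 2 ≤ Φ.N n) {j : ℕ} (hj : j ≤ Φ.N n) :
    (V Φ n 19 0 j 0 0 0 0 0 : ℤ) - V Φ n 19 1 j 0 0 0 0 0 = qsqZ Φ n j := by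
  have hNpos : 0 < Φ.N n := by omega
  obtain ⟨hFB, h2X, h2R, h2NN, h2N1, hXeq, hTF, hTFB, hLreq⟩ := Φ.param_facts n
  have hw : ∀ s, s ≤ 1 → WF Φ n (Φ.Lreq n) [19, s, j, 0, 0, 0, 0, 0] := fun s hs =>
    wf_mk Φ hNpos (by norm_num) hs (by omega) (by omega) (by omega) (by omega) hj
  have hP : ∀ s k, s ≤ 1 → k < 2 * (Φ.N n * Φ.N n) → WF Φ n (Φ.Lreq n) [20, s, j, k, 0, 0, 0, 0] := fun s k hs hk =>
    wf_mk Φ hNpos (by norm_num) hs (by omega) (by omega) (by omega) (by omega) ⟨hj, hk⟩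
  rw [V_QSQ Φ (hw 0 (by norm_num)) (hP 0 · (by norm_num)), V_QSQ Φ (hw 1 (by norm_num)) (hP 1 · (by norm_num)), qsqZ]
  refine pairProd_sub (Φ.N n * Φ.N n) (fun e w => V Φ n 18 e j (w / Φ.N n) (w % Φ.N n) 0 0 0)
    (fun e w => V Φ n 18 e j (w / Φ.N n) (w % Φ.N n) 0 0 0)
    (fun w => qbZ Φ n j (w / Φ.N n) (w % Φ.N n)) (fun w => qbZ Φ n j (w / Φ.N n) (w % Φ.N n))
    (fun w hw2 => V_QB_sub Φ hN hj (Nat.div_lt_of_lt_mul hw2) (Nat.mod_lt _ hNpos))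
    (fun w hw2 => V_QB_sub Φ hN hj (Nat.div_lt_of_lt_mul hw2) (Nat.mod_lt _ hNpos))

/-- **`NT2(s,j',a,b)`**: `[q_B(B)B^{j'} ≠ 0]·QB(s,j',a,b)`. [cite: KoiranPerifel2009VPSPACE, §3.2 (select gates)] -/
theorem V_NT2 (hN : 2 ≤ Φ.N n) {s j' a b : ℕ} (hs : s ≤ 1) (hj : j' < Φ.N n) (ha : a < Φ.N n) (hb : b < Φ.N n) :
    V Φ n 22 s j' a b 0 0 0 = if qsqZ Φ n j' = 0 then 0 else V Φ n 18 s j' a b 0 0 0 := by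
  have hNpos : 0 < Φ.N n := by omega
  obtain ⟨hFB, h2X, h2R, h2NN, h2N1, hXeq, hTF, hTFB, hLreq⟩ := Φ.param_facts n
  have h : WF Φ n (Φ.Lreq n) [22, s, j', a, b, 0, 0, 0] :=
    wf_mk Φ hNpos (by norm_num) hs (by omega) (by omega) (by omega) (by omega) ⟨hj, ha, hb⟩
  have hC : ∀ e, e ≤ 1 → WF Φ n (Φ.Lreq n) [19, e, j', 0, 0, 0, 0, 0] := fun e he =>
    wf_mk Φ hNpos (by norm_num) he (by omega) (by omega) (by omega) (by omega) (by omega : j' ≤ Φ.N n)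
  have hZ : WF Φ n (Φ.Lreq n) [30, 0, 0, 0, 0, 0, 0, 0] :=
    wf_mk Φ hNpos (by norm_num) (by norm_num) (by omega) (by omega) (by omega) (by omega) trivial
  have hk := K_kind Φ h; rw [kind_NT2 Φ h] at hk
  unfold V
  rw [(kvc Φ).val_mux hk, K_width Φ h, width_NT2 Φ h]
  simp only [K_child Φ h, child_NT2_0, child_NT2_1, child_NT2_2, child_NT2_3]
  change (if V Φ n 19 0 j' 0 0 0 0 0 % 2 ^ Φ.Wmux n = V Φ n 19 1 j' 0 0 0 0 0 % 2 ^ Φ.Wmux n then V Φ n 30 0 0 0 0 0 0 0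
    else V Φ n 18 s j' a b 0 0 0) = _
  rw [V_mod Φ (hC 0 (by norm_num)), V_mod Φ (hC 1 (by norm_num)), V_ZERO Φ hZ]
  have hiff := nat_eq_iff_sub_eq_zero (V_QSQ_sub Φ hN (j := j') (by omega))
  by_cases hc : qsqZ Φ n j' = 0
  · rw [if_pos (hiff.2 hc), if_pos hc]
  · rw [if_neg (mt hiff.1 hc), if_neg hc]; rfl

/-- **`NT(s,j',a,b)`**: `[q_B(B)B^{j'+1} = 0]·NT2`. [cite: KoiranPerifel2009VPSPACE, §3.2 (select gates)] -/
theorem V_NT (hN : 2 ≤ Φ.N n) {s j' a b : ℕ} (hs : s ≤ 1) (hj : j' < Φ.N n) (ha : a < Φ.N n) (hb : b < Φ.N n) :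
    V Φ n 21 s j' a b 0 0 0 = if qsqZ Φ n (j' + 1) = 0 then V Φ n 22 s j' a b 0 0 0 else 0 := by
  have hNpos : 0 < Φ.N n := by omega
  obtain ⟨hFB, h2X, h2R, h2NN, h2N1, hXeq, hTF, hTFB, hLreq⟩ := Φ.param_facts n
  have h : WF Φ n (Φ.Lreq n) [21, s, j', a, b, 0, 0, 0] :=
    wf_mk Φ hNpos (by norm_num) hs (by omega) (by omega) (by omega) (by omega) ⟨hj, ha, hb⟩
  have hC : ∀ e, e ≤ 1 → WF Φ n (Φ.Lreq n) [19, e, j' + 1, 0, 0, 0, 0, 0] := fun e he =>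
    wf_mk Φ hNpos (by norm_num) he (by omega) (by omega) (by omega) (by omega) (by omega : j' + 1 ≤ Φ.N n)
  have hZ : WF Φ n (Φ.Lreq n) [30, 0, 0, 0, 0, 0, 0, 0] :=
    wf_mk Φ hNpos (by norm_num) (by norm_num) (by omega) (by omega) (by omega) (by omega) trivial
  have hk := K_kind Φ h; rw [kind_NT Φ h] at hk
  unfold V
  rw [(kvc Φ).val_mux hk, K_width Φ h, width_NT Φ h]
  simp only [K_child Φ h, child_NT_0, child_NT_1, child_NT_2, child_NT_3]
  change (if V Φ n 19 0 (j' + 1) 0 0 0 0 0 % 2 ^ Φ.Wmux n = V Φ n 19 1 (j' + 1) 0 0 0 0 0 % 2 ^ Φ.Wmux n then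
    V Φ n 22 s j' a b 0 0 0 else V Φ n 30 0 0 0 0 0 0 0) = _
  rw [V_mod Φ (hC 0 (by norm_num)), V_mod Φ (hC 1 (by norm_num)), V_ZERO Φ hZ]
  have hiff := nat_eq_iff_sub_eq_zero (V_QSQ_sub Φ hN (j := j' + 1) (by omega))
  by_cases hc : qsqZ Φ n (j' + 1) = 0
  · rw [if_pos (hiff.2 hc), if_pos hc]; rfl
  · rw [if_neg (mt hiff.1 hc), if_neg hc]

/-- `NT⁺ − NT⁻ = [j'+1 = j₀]·(q_B(B)B^{j'})_{ab}`. [cite: BorodinVonzurgathenHopcroft1982, §4; KoiranPerifel2009VPSPACE, §3.2] -/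
theorem V_NT_sub (hN : 2 ≤ Φ.N n) {j' a b : ℕ} (hj : j' < Φ.N n) (ha : a < Φ.N n) (hb : b < Φ.N n) :
    (V Φ n 21 0 j' a b 0 0 0 : ℤ) - V Φ n 21 1 j' a b 0 0 0 = if j' + 1 = j0 Φ n then qbZ Φ n j' a b else 0 := by
  rw [V_NT Φ hN (by norm_num) hj ha hb, V_NT Φ hN (by norm_num) hj ha hb, V_NT2 Φ hN (by norm_num) hj ha hb,
    V_NT2 Φ hN (by norm_num) hj ha hb, ← V_QB_sub Φ hN hj.le ha hb]
  have key : (qsqZ Φ n (j' + 1) = 0 ∧ qsqZ Φ n j' ≠ 0) ↔ j' + 1 = j0 Φ n := by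
    rw [qsqZ_eq_zero_iff Φ hN, ne_eq, qsqZ_eq_zero_iff Φ hN]; exact j0_iff Φ j'
  by_cases h1 : qsqZ Φ n (j' + 1) = 0 <;> by_cases h2 : qsqZ Φ n j' = 0
  · have h3 : ¬ j' + 1 = j0 Φ n := fun h => (key.2 h).2 h2
    simp [h1, h2, h3]
  · have h3 : j' + 1 = j0 Φ n := key.1 ⟨h1, h2⟩
    rw [if_pos h3]; simp [h1, h2]
  · have h3 : ¬ j' + 1 = j0 Φ n := fun h => h1 (key.2 h).1
    simp [h1, h3]
  · have h3 : ¬ j' + 1 = j0 Φ n := fun h => h1 (key.2 h).1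
    simp [h1, h3]

/-- **`NB(s,a,b)`**: the sum of the `N` selects `NT(s,j',a,b)`. [cite: KoiranPerifel2009VPSPACE, §3.2, Prop. 1] -/
theorem V_NB (h : WF Φ n (Φ.Lreq n) [23, s, f1, f2, 0, 0, 0, 0]) :
    V Φ n 23 s f1 f2 0 0 0 0 = ∑ j' ∈ range (Φ.N n), V Φ n 21 s j' f1 f2 0 0 0 := by
  have hk := K_kind Φ h; rw [kind_NB Φ h] at hk
  unfold V
  rw [(kvc Φ).val_sum hk, K_arity Φ h, arity_NB Φ h]
  refine sum_congr rfl fun k _ => ?_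
  rw [K_child Φ h, child_NB]; rfl

/-- ★ **`NB⁺ − NB⁻ = (N_B)_{ab}`**, the kernel matrix: exactly the summand `j' = j₀ − 1` survives.
[cite: BorodinVonzurgathenHopcroft1982, §4 (p0012:L46–66) and §5 (p0026:L36–37 NULLSPACE); KoiranPerifel2009VPSPACE, §3.2] -/
theorem V_NB_sub (hN : 2 ≤ Φ.N n) {a b : ℕ} (ha : a < Φ.N n) (hb : b < Φ.N n) :
    (V Φ n 23 0 a b 0 0 0 0 : ℤ) - V Φ n 23 1 a b 0 0 0 0 = nbZ Φ n a b := by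
  have hNpos : 0 < Φ.N n := by omega
  obtain ⟨hFB, h2X, h2R, h2NN, h2N1, hXeq, hTF, hTFB, hLreq⟩ := Φ.param_facts n
  have hw : ∀ s, s ≤ 1 → WF Φ n (Φ.Lreq n) [23, s, a, b, 0, 0, 0, 0] := fun s hs =>
    wf_mk Φ hNpos (by norm_num) hs (by omega) (by omega) (by omega) (by omega) ⟨ha, hb⟩
  rw [V_NB Φ (hw 0 (by norm_num)), V_NB Φ (hw 1 (by norm_num)),
    pairSum_sub (Φ.N n) (fun e j' => V Φ n 21 e j' a b 0 0 0)
      (fun j' => if j' + 1 = j0 Φ n then qbZ Φ n j' a b else 0) (fun j' hj' => V_NT_sub Φ hN hj' ha hb),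
    nbZ_eq Φ hN ha hb]
  have hj0 := j0_le Φ hN
  split_ifs with hpos
  · rw [sum_congr rfl (fun j' _ => show (if j' + 1 = j0 Φ n then qbZ Φ n j' a b else 0) =
        (if j' = j0 Φ n - 1 then qbZ Φ n j' a b else 0) by
          by_cases h : j' = j0 Φ n - 1
          · rw [if_pos h, if_pos (by omega)]
          · rw [if_neg h, if_neg (by omega)]),
      Finset.sum_ite_eq', if_pos (mem_range.2 (by omega))]
  · exact sum_eq_zero fun j' _ => if_neg (by omega)

end NPart


/-! ### Values of `COLSQ`, `PRE`, `VT`, `V`: the least nonzero column of `N_B` -/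

section VPart
variable {n : ℕ}

/-- `Σ_{r<N} (N_B)_{rc}²`. [cite: BorodinVonzurgathenHopcroft1982, §5 (NULLSPACE)] -/
def colsqZ (n c : ℕ) : ℤ := ∑ r ∈ range (Φ.N n), nbZ Φ n r c * nbZ Φ n r c

/-- `Σ_{c'<c} colsq c'`. [cite: BorodinVonzurgathenHopcroft1982, §5 (NULLSPACE)] -/
def preZ (n c : ℕ) : ℤ := ∑ c' ∈ range c, colsqZ Φ n c'

/-- The entries of `charpolyKernelVector (AᵀA)` on natural indices. [cite: BorodinVonzurgathenHopcroft1982, §5 (NULLSPACE)] -/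
def kvZ (n r : ℕ) : ℤ := if h : r < N2 Φ n + 2 then charpolyKernelVector (Bfin Φ n) ⟨r, h⟩ else 0

/-- `colsq c = 0 ↔` column `c` of `N_B` vanishes. [cite: BorodinVonzurgathenHopcroft1982, §5] -/
theorem colsqZ_eq_zero_iff (hN : 2 ≤ Φ.N n) {c : ℕ} (hc : c < Φ.N n) :
    colsqZ Φ n c = 0 ↔ (charpolyKernelMatrix (Bfin Φ n)).transpose ⟨c, by rw [N2_add_two Φ hN]; exact hc⟩ = 0 := by
  have hNe := N2_add_two Φ hN
  have hc' : c < N2 Φ n + 2 := by omega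
  unfold colsqZ
  rw [sum_mul_self_eq_zero_iff]
  constructor
  · intro h
    funext r
    have h1 := h r (mem_range.2 (by rw [← hNe]; exact r.isLt))
    unfold nbZ at h1
    rw [dif_pos ⟨r.isLt, hc'⟩] at h1
    exact h1
  · intro h r hr
    have hr' : r < N2 Φ n + 2 := by rw [hNe]; exact mem_range.1 hr
    have h1 := congrFun h ⟨r, hr'⟩
    unfold nbZ
    rw [dif_pos ⟨hr', hc'⟩]
    exact h1

/-- `colsq c ≥ 0`. [cite: BorodinVonzurgathenHopcroft1982, §4 (linear algebra of the characteristic polynomial)] -/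
theorem colsqZ_nonneg (c : ℕ) : 0 ≤ colsqZ Φ n c :=
  sum_nonneg fun _ _ => mul_self_nonneg _

/-- `pre c = 0 ↔ colsq c' = 0` for all `c' < c`. [cite: BorodinVonzurgathenHopcroft1982, §5] -/
theorem preZ_eq_zero_iff (c : ℕ) : preZ Φ n c = 0 ↔ ∀ c', c' < c → colsqZ Φ n c' = 0 := by
  unfold preZ
  rw [sum_eq_zero_iff_of_nonneg (fun c' _ => colsqZ_nonneg Φ c')]
  exact ⟨fun h c' hc' => h c' (mem_range.2 hc'), fun h c' hc' => h c' (mem_range.1 hc')⟩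

/-- The minimum of a finset characterised by a predicate is its least witness. [folklore] -/
private theorem min'_eq_of_least {m : ℕ} (S : Finset (Fin m)) (hS : S.Nonempty) (P : Fin m → Prop)
    (hmem : ∀ x, x ∈ S ↔ P x) (c : Fin m) (hc : P c) (hlt : ∀ c' < c, ¬ P c') : S.min' hS = c :=
  le_antisymm (Finset.min'_le _ _ ((hmem c).2 hc))
    (by by_contra h; exact hlt _ (not_le.1 h) ((hmem _).1 (Finset.min'_mem _ hS)))

/-- `v_B` is column `c` of `N_B` when that column is nonzero and all earlier ones vanish. [cite: BorodinVonzurgathenHopcroft1982, §5 (NULLSPACE)] -/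
theorem kv_of_least {m : ℕ} (B : Matrix (Fin m) (Fin m) ℤ) (c : Fin m) (hc : (charpolyKernelMatrix B).transpose c ≠ 0)
    (hlt : ∀ c' < c, (charpolyKernelMatrix B).transpose c' = 0) :
    charpolyKernelVector B = (charpolyKernelMatrix B).transpose c := by
  unfold charpolyKernelVector
  split_ifs with hS
  · rw [min'_eq_of_least _ hS (fun x => (charpolyKernelMatrix B).transpose x ≠ 0)
      (fun x => by simp only [Finset.mem_filter, Finset.mem_univ, true_and]) c hc (fun c' hc' h => h (hlt c' hc'))]
  · exact absurd ⟨c, by simp only [Finset.mem_filter, Finset.mem_univ, true_and]; exact hc⟩ hS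

/-- `v_B = 0` when `N_B` has no nonzero column. [cite: BorodinVonzurgathenHopcroft1982, §5 (NULLSPACE)] -/
theorem kv_of_all_zero {m : ℕ} (B : Matrix (Fin m) (Fin m) ℤ) (h : ∀ c, (charpolyKernelMatrix B).transpose c = 0) :
    charpolyKernelVector B = 0 := by
  unfold charpolyKernelVector
  split_ifs with hS
  · obtain ⟨c, hc⟩ := hS
    simp only [Finset.mem_filter, Finset.mem_univ, true_and] at hc
    exact absurd (h c) hc
  · rfl

/-- ★ **The least-nonzero-column selection computes `charpolyKernelVector`.** [cite: BorodinVonzurgathenHopcroft1982, §5 (p0026:L36–37 NULLSPACE)] -/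
theorem kvZ_eq_sum (hN : 2 ≤ Φ.N n) {r : ℕ} (hr : r < Φ.N n) :
    kvZ Φ n r = ∑ c ∈ range (Φ.N n), if preZ Φ n c = 0 ∧ colsqZ Φ n c ≠ 0 then nbZ Φ n r c else 0 := by
  have hNe := N2_add_two Φ hN
  have hr' : r < N2 Φ n + 2 := by omega
  unfold kvZ
  rw [dif_pos hr']
  by_cases hex : ∃ c, c < Φ.N n ∧ colsqZ Φ n c ≠ 0
  · -- the least nonzero column `c₀`
    classical
    let c₀ := Nat.find hex
    have hc₀ : c₀ < Φ.N n ∧ colsqZ Φ n c₀ ≠ 0 := Nat.find_spec hex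
    have hmin : ∀ c', c' < c₀ → colsqZ Φ n c' = 0 := fun c' hc' => by
      by_contra hne
      exact Nat.find_min hex hc' ⟨by omega, hne⟩
    have hsel : ∀ c, c < Φ.N n → ((preZ Φ n c = 0 ∧ colsqZ Φ n c ≠ 0) ↔ c = c₀) := by
      intro c hc
      rw [preZ_eq_zero_iff]
      constructor
      · rintro ⟨hpre, hnz⟩
        rcases lt_trichotomy c c₀ with h | h | h
        · exact absurd (hmin c h) hnz
        · exact h
        · exact absurd (hpre c₀ h) hc₀.2
      · rintro rfl; exact ⟨hmin, hc₀.2⟩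
    rw [sum_congr rfl (fun c hc => show (if preZ Φ n c = 0 ∧ colsqZ Φ n c ≠ 0 then nbZ Φ n r c else 0) =
        (if c = c₀ then nbZ Φ n r c else 0) by
          by_cases h : c = c₀
          · rw [if_pos h, if_pos ((hsel c (mem_range.1 hc)).2 h)]
          · rw [if_neg h, if_neg (mt (hsel c (mem_range.1 hc)).1 h)]),
      Finset.sum_ite_eq', if_pos (mem_range.2 hc₀.1)]
    have hc₀' : c₀ < N2 Φ n + 2 := by omega
    have hcol : (charpolyKernelMatrix (Bfin Φ n)).transpose ⟨c₀, hc₀'⟩ ≠ 0 :=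
      fun h => hc₀.2 ((colsqZ_eq_zero_iff Φ hN hc₀.1).2 h)
    have hlt : ∀ c' < (⟨c₀, hc₀'⟩ : Fin (N2 Φ n + 2)), (charpolyKernelMatrix (Bfin Φ n)).transpose c' = 0 := by
      intro c' hc'
      have hc'N : (c' : ℕ) < Φ.N n := by have := c'.isLt; omega
      have := (colsqZ_eq_zero_iff Φ hN hc'N).1 (hmin c' hc')
      exact this
    rw [kv_of_least (Bfin Φ n) ⟨c₀, hc₀'⟩ hcol hlt]
    unfold nbZ
    rw [dif_pos ⟨hr', hc₀'⟩]
    rfl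
  · -- every column vanishes
    have hex' : ∀ c, c < Φ.N n → colsqZ Φ n c = 0 := fun c hc => by by_contra hne; exact hex ⟨c, hc, hne⟩
    rw [kv_of_all_zero (Bfin Φ n) (fun c => (colsqZ_eq_zero_iff Φ hN (c := c) (by rw [← hNe]; exact c.isLt)).1
      (hex' c (by rw [← hNe]; exact c.isLt)))]
    rw [sum_eq_zero (fun c hc => if_neg (fun h => h.2 (hex' c (mem_range.1 hc))))]
    rfl

/-- **`COLSQ(s,c)`**: the sum of the `2N` products `PN = NB·NB`. [cite: KoiranPerifel2009VPSPACE, §3.2, Prop. 1] -/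
theorem V_COLSQ (h : WF Φ n (Φ.Lreq n) [24, s, f1, 0, 0, 0, 0, 0])
    (hP : ∀ k, k < 2 * Φ.N n → WF Φ n (Φ.Lreq n) [25, s, f1, k, 0, 0, 0, 0]) :
    V Φ n 24 s f1 0 0 0 0 0 =
      ∑ k ∈ range (2 * Φ.N n), V Φ n 23 (k % 2) (k / 2) f1 0 0 0 0 * V Φ n 23 ((k % 2 + s) % 2) (k / 2) f1 0 0 0 0 := by
  have hk := K_kind Φ h; rw [kind_COLSQ Φ h] at hk
  unfold V
  rw [(kvc Φ).val_sum hk, K_arity Φ h, arity_COLSQ Φ h]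
  refine sum_congr rfl fun k hk' => ?_
  have hkk := mem_range.1 hk'
  rw [K_child Φ h, child_COLSQ]
  have hk2 := K_kind Φ (hP k hkk); rw [kind_PN Φ (hP k hkk)] at hk2
  rw [show gname (Φ.Lreq n) n [25, s, f1, k, 0, 0, 0, 0] = G Φ n 25 s f1 k 0 0 0 0 from rfl,
    (kvc Φ).val_mul hk2, K_child Φ (hP k hkk), K_child Φ (hP k hkk), child_PN_0, child_PN_1]
  rfl

/-- ★ `COLSQ⁺ − COLSQ⁻ = Σ_r (N_B)_{rc}²`. [cite: BorodinVonzurgathenHopcroft1982, §5; KoiranPerifel2009VPSPACE, §3.2] -/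
theorem V_COLSQ_sub (hN : 2 ≤ Φ.N n) {c : ℕ} (hc : c < Φ.N n) :
    (V Φ n 24 0 c 0 0 0 0 0 : ℤ) - V Φ n 24 1 c 0 0 0 0 0 = colsqZ Φ n c := by
  have hNpos : 0 < Φ.N n := by omega
  obtain ⟨hFB, h2X, h2R, h2NN, h2N1, hXeq, hTF, hTFB, hLreq⟩ := Φ.param_facts n
  have hw : ∀ s, s ≤ 1 → WF Φ n (Φ.Lreq n) [24, s, c, 0, 0, 0, 0, 0] := fun s hs =>
    wf_mk Φ hNpos (by norm_num) hs (by omega) (by omega) (by omega) (by omega) hc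
  have hP : ∀ s k, s ≤ 1 → k < 2 * Φ.N n → WF Φ n (Φ.Lreq n) [25, s, c, k, 0, 0, 0, 0] := fun s k hs hk =>
    wf_mk Φ hNpos (by norm_num) hs (by omega) (by omega) (by omega) (by omega) ⟨hc, hk⟩
  rw [V_COLSQ Φ (hw 0 (by norm_num)) (hP 0 · (by norm_num)), V_COLSQ Φ (hw 1 (by norm_num)) (hP 1 · (by norm_num)),
    colsqZ]
  exact pairProd_sub (Φ.N n) (fun e r => V Φ n 23 e r c 0 0 0 0) (fun e r => V Φ n 23 e r c 0 0 0 0)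
    (fun r => nbZ Φ n r c) (fun r => nbZ Φ n r c)
    (fun r hr => V_NB_sub Φ hN hr hc) (fun r hr => V_NB_sub Φ hN hr hc)

/-- **`PRE(s,c)`**: the sum of the `c` gates `COLSQ(s,c')`, `c' < c`. [cite: KoiranPerifel2009VPSPACE, §3.2, Prop. 1] -/
theorem V_PRE (h : WF Φ n (Φ.Lreq n) [26, s, f1, 0, 0, 0, 0, 0]) :
    V Φ n 26 s f1 0 0 0 0 0 = ∑ c' ∈ range f1, V Φ n 24 s c' 0 0 0 0 0 := by
  have hk := K_kind Φ h; rw [kind_PRE Φ h] at hk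
  unfold V
  rw [(kvc Φ).val_sum hk, K_arity Φ h, arity_PRE Φ h]
  refine sum_congr rfl fun k _ => ?_
  rw [K_child Φ h, child_PRE]; rfl

/-- `PRE⁺ − PRE⁻ = Σ_{c'<c} colsq c'`. [cite: BorodinVonzurgathenHopcroft1982, §5; KoiranPerifel2009VPSPACE, §3.2] -/
theorem V_PRE_sub (hN : 2 ≤ Φ.N n) {c : ℕ} (hc : c ≤ Φ.N n) :
    (V Φ n 26 0 c 0 0 0 0 0 : ℤ) - V Φ n 26 1 c 0 0 0 0 0 = preZ Φ n c := by
  have hNpos : 0 < Φ.N n := by omega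
  obtain ⟨hFB, h2X, h2R, h2NN, h2N1, hXeq, hTF, hTFB, hLreq⟩ := Φ.param_facts n
  have hw : ∀ s, s ≤ 1 → WF Φ n (Φ.Lreq n) [26, s, c, 0, 0, 0, 0, 0] := fun s hs =>
    wf_mk Φ hNpos (by norm_num) hs (by omega) (by omega) (by omega) (by omega) hc
  rw [V_PRE Φ (hw 0 (by norm_num)), V_PRE Φ (hw 1 (by norm_num)), preZ]
  exact pairSum_sub c (fun e c' => V Φ n 24 e c' 0 0 0 0 0) (colsqZ Φ n) (fun c' hc' => V_COLSQ_sub Φ hN (by omega))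

/-- **`VT2(s,c,r)`**: `[column c of N_B ≠ 0]·NB(s,r,c)`. [cite: KoiranPerifel2009VPSPACE, §3.2 (select gates)] -/
theorem V_VT2 (hN : 2 ≤ Φ.N n) {s c r : ℕ} (hs : s ≤ 1) (hc : c < Φ.N n) (hr : r < Φ.N n) :
    V Φ n 28 s c r 0 0 0 0 = if colsqZ Φ n c = 0 then 0 else V Φ n 23 s r c 0 0 0 0 := by
  have hNpos : 0 < Φ.N n := by omega
  obtain ⟨hFB, h2X, h2R, h2NN, h2N1, hXeq, hTF, hTFB, hLreq⟩ := Φ.param_facts n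
  have h : WF Φ n (Φ.Lreq n) [28, s, c, r, 0, 0, 0, 0] :=
    wf_mk Φ hNpos (by norm_num) hs (by omega) (by omega) (by omega) (by omega) ⟨hc, hr⟩
  have hC : ∀ e, e ≤ 1 → WF Φ n (Φ.Lreq n) [24, e, c, 0, 0, 0, 0, 0] := fun e he =>
    wf_mk Φ hNpos (by norm_num) he (by omega) (by omega) (by omega) (by omega) hc
  have hZ : WF Φ n (Φ.Lreq n) [30, 0, 0, 0, 0, 0, 0, 0] :=
    wf_mk Φ hNpos (by norm_num) (by norm_num) (by omega) (by omega) (by omega) (by omega) trivial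
  have hk := K_kind Φ h; rw [kind_VT2 Φ h] at hk
  unfold V
  rw [(kvc Φ).val_mux hk, K_width Φ h, width_VT2 Φ h]
  simp only [K_child Φ h, child_VT2_0, child_VT2_1, child_VT2_2, child_VT2_3]
  change (if V Φ n 24 0 c 0 0 0 0 0 % 2 ^ Φ.Wmux n = V Φ n 24 1 c 0 0 0 0 0 % 2 ^ Φ.Wmux n then V Φ n 30 0 0 0 0 0 0 0
    else V Φ n 23 s r c 0 0 0 0) = _
  rw [V_mod Φ (hC 0 (by norm_num)), V_mod Φ (hC 1 (by norm_num)), V_ZERO Φ hZ]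
  have hiff := nat_eq_iff_sub_eq_zero (V_COLSQ_sub Φ hN hc)
  by_cases hz : colsqZ Φ n c = 0
  · rw [if_pos (hiff.2 hz), if_pos hz]
  · rw [if_neg (mt hiff.1 hz), if_neg hz]; rfl

/-- **`VT(s,c,r)`**: `[columns < c of N_B vanish]·VT2`. [cite: KoiranPerifel2009VPSPACE, §3.2 (select gates)] -/
theorem V_VT (hN : 2 ≤ Φ.N n) {s c r : ℕ} (hs : s ≤ 1) (hc : c < Φ.N n) (hr : r < Φ.N n) :
    V Φ n 27 s c r 0 0 0 0 = if preZ Φ n c = 0 then V Φ n 28 s c r 0 0 0 0 else 0 := by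
  have hNpos : 0 < Φ.N n := by omega
  obtain ⟨hFB, h2X, h2R, h2NN, h2N1, hXeq, hTF, hTFB, hLreq⟩ := Φ.param_facts n
  have h : WF Φ n (Φ.Lreq n) [27, s, c, r, 0, 0, 0, 0] :=
    wf_mk Φ hNpos (by norm_num) hs (by omega) (by omega) (by omega) (by omega) ⟨hc, hr⟩
  have hC : ∀ e, e ≤ 1 → WF Φ n (Φ.Lreq n) [26, e, c, 0, 0, 0, 0, 0] := fun e he =>
    wf_mk Φ hNpos (by norm_num) he (by omega) (by omega) (by omega) (by omega) (by omega : c ≤ Φ.N n)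
  have hZ : WF Φ n (Φ.Lreq n) [30, 0, 0, 0, 0, 0, 0, 0] :=
    wf_mk Φ hNpos (by norm_num) (by norm_num) (by omega) (by omega) (by omega) (by omega) trivial
  have hk := K_kind Φ h; rw [kind_VT Φ h] at hk
  unfold V
  rw [(kvc Φ).val_mux hk, K_width Φ h, width_VT Φ h]
  simp only [K_child Φ h, child_VT_0, child_VT_1, child_VT_2, child_VT_3]
  change (if V Φ n 26 0 c 0 0 0 0 0 % 2 ^ Φ.Wmux n = V Φ n 26 1 c 0 0 0 0 0 % 2 ^ Φ.Wmux n then V Φ n 28 s c r 0 0 0 0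
    else V Φ n 30 0 0 0 0 0 0 0) = _
  rw [V_mod Φ (hC 0 (by norm_num)), V_mod Φ (hC 1 (by norm_num)), V_ZERO Φ hZ]
  have hiff := nat_eq_iff_sub_eq_zero (V_PRE_sub Φ hN hc.le)
  by_cases hz : preZ Φ n c = 0
  · rw [if_pos (hiff.2 hz), if_pos hz]; rfl
  · rw [if_neg (mt hiff.1 hz), if_neg hz]

/-- `VT⁺ − VT⁻ = [c is the least nonzero column]·(N_B)_{rc}`. [cite: BorodinVonzurgathenHopcroft1982, §5; KoiranPerifel2009VPSPACE, §3.2] -/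
theorem V_VT_sub (hN : 2 ≤ Φ.N n) {c r : ℕ} (hc : c < Φ.N n) (hr : r < Φ.N n) :
    (V Φ n 27 0 c r 0 0 0 0 : ℤ) - V Φ n 27 1 c r 0 0 0 0 =
      if preZ Φ n c = 0 ∧ colsqZ Φ n c ≠ 0 then nbZ Φ n r c else 0 := by
  rw [V_VT Φ hN (by norm_num) hc hr, V_VT Φ hN (by norm_num) hc hr, V_VT2 Φ hN (by norm_num) hc hr,
    V_VT2 Φ hN (by norm_num) hc hr, ← V_NB_sub Φ hN hr hc]
  by_cases h1 : preZ Φ n c = 0 <;> by_cases h2 : colsqZ Φ n c = 0 <;> simp [h1, h2]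

/-- **`V(s,r)`**: the sum of the `N` selects `VT(s,c,r)`. [cite: KoiranPerifel2009VPSPACE, §3.2, Prop. 1] -/
theorem V_V (h : WF Φ n (Φ.Lreq n) [29, s, f1, 0, 0, 0, 0, 0]) :
    V Φ n 29 s f1 0 0 0 0 0 = ∑ c ∈ range (Φ.N n), V Φ n 27 s c f1 0 0 0 0 := by
  have hk := K_kind Φ h; rw [kind_V Φ h] at hk
  unfold V
  rw [(kvc Φ).val_sum hk, K_arity Φ h, arity_V Φ h]
  refine sum_congr rfl fun k _ => ?_
  rw [K_child Φ h, child_V]; rfl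

/-- ★★ **`V⁺ − V⁻ = charpolyKernelVector (AᵀA) r`**: the output gate pair of the circuit computes the
canonical kernel vector. [cite: BorodinVonzurgathenHopcroft1982, §5 (p0026:L36–37 NULLSPACE); KoiranPerifel2009VPSPACE, §3.2, Prop. 1] -/
theorem V_V_sub (hN : 2 ≤ Φ.N n) {r : ℕ} (hr : r < Φ.N n) :
    (V Φ n 29 0 r 0 0 0 0 0 : ℤ) - V Φ n 29 1 r 0 0 0 0 0 = kvZ Φ n r := by
  have hNpos : 0 < Φ.N n := by omega
  obtain ⟨hFB, h2X, h2R, h2NN, h2N1, hXeq, hTF, hTFB, hLreq⟩ := Φ.param_facts n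
  have hw : ∀ s, s ≤ 1 → WF Φ n (Φ.Lreq n) [29, s, r, 0, 0, 0, 0, 0] := fun s hs =>
    wf_mk Φ hNpos (by norm_num) hs (by omega) (by omega) (by omega) (by omega) hr
  rw [V_V Φ (hw 0 (by norm_num)), V_V Φ (hw 1 (by norm_num)), kvZ_eq_sum Φ hN hr]
  exact pairSum_sub (Φ.N n) (fun e c => V Φ n 27 e c r 0 0 0 0)
    (fun c => if preZ Φ n c = 0 ∧ colsqZ Φ n c ≠ 0 then nbZ Φ n r c else 0) (fun c hc => V_VT_sub Φ hN hc hr)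

end VPart


/-! ### The output: designated gate names, their `FP` code, and the kernel vector of `AᵀA` -/

section Output
variable {n : ℕ}

/-- The `n`-th matrix of the family on its index types. [cite: BorodinVonzurgathenHopcroft1982, §4] -/
def Amat (n : ℕ) : Matrix (Fin (Φ.R n)) (Fin (Φ.N n)) ℤ := Matrix.of fun r c => Φ.A n r c

/-- The Gram matrix of the family is `b` entrywise. [cite: KumarVolk2022, §6 (proof of Cor. 1.3)] -/
theorem gram_apply (i j : Fin (Φ.N n)) : ((Amat Φ n).transpose * Amat Φ n) i j = bZ Φ n i j := by
  rw [Matrix.mul_apply, bZ, ← Fin.sum_univ_eq_sum_range (fun r => Φ.A n r i * Φ.A n r j)]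
  rfl

/-- The Gram matrix as `Matrix.of b`. [cite: KumarVolk2022, §6 (proof of Cor. 1.3)] -/
theorem gram_eq_of : (Amat Φ n).transpose * Amat Φ n = Matrix.of fun (i j : Fin (Φ.N n)) => bZ Φ n i j := by
  ext i j; rw [gram_apply, Matrix.of_apply]

/-- Transport of `charpolyKernelVector (Matrix.of f)` along an equality of sizes. [cite: BorodinVonzurgathenHopcroft1982, §4 (linear algebra of the characteristic polynomial)] -/
theorem charpolyKernelVector_of_cast (f : ℕ → ℕ → ℤ) {a b : ℕ} (h : a = b) (r : ℕ) (hr : r < a) :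
    charpolyKernelVector (Matrix.of fun (i j : Fin a) => f i j) ⟨r, hr⟩ =
      charpolyKernelVector (Matrix.of fun (i j : Fin b) => f i j) ⟨r, h ▸ hr⟩ := by
  subst h; rfl

/-- ★ `kvZ r = charpolyKernelVector (AᵀA) r` on the family's own index type. [cite: BorodinVonzurgathenHopcroft1982, §5 (NULLSPACE)] -/
theorem kvZ_eq_gram (hN : 2 ≤ Φ.N n) (c : Fin (Φ.N n)) :
    kvZ Φ n c = charpolyKernelVector ((Amat Φ n).transpose * Amat Φ n) c := by
  have hNe := N2_add_two Φ hN
  have hc' : (c : ℕ) < N2 Φ n + 2 := by rw [hNe]; exact c.isLt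
  unfold kvZ Bfin
  rw [dif_pos hc', gram_eq_of, charpolyKernelVector_of_cast (fun i j => bZ Φ n i j) hNe c hc']

/-- **The designated output gate names** `V(s, c)` of the `n`-th circuit. [cite: KoiranPerifel2009VPSPACE, §3.2] -/
def outName (n s c : ℕ) : List Bool := gname (Φ.Lreq n) n [29, s, c, 0, 0, 0, 0, 0]

/-- `Lreq` in unary is polynomial-time (plumbing). [folklore] -/
private theorem fp_Lreq_un : CodeFP unE unE Φ.Lreq := by
  have hFb : CodeFP unE unE Φ.Fb :=
    (unAdd.comp ((unAdd.comp ((unAdd.comp (Φ.F_fp.pair Φ.F_fp)).pair Φ.F_fp)).pair (const _ 5))).congr fun n => by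
      show Φ.F n + Φ.F n + Φ.F n + 5 = Φ.Fb n; unfold SuccIntMatrixFamily.Fb; ring
  have hG : CodeFP unE unE (fun n => 2 * Φ.Fb n + 2) :=
    (unAdd.comp ((unAdd.comp (hFb.pair hFb)).pair (const _ 2))).congr fun n => by show Φ.Fb n + Φ.Fb n + 2 = _; ring
  have hG2 : CodeFP unE unE (fun n => 2 * (2 * Φ.Fb n + 2)) := (unAdd.comp (hG.pair hG)).congr fun n => by
    show (2 * Φ.Fb n + 2) + (2 * Φ.Fb n + 2) = _; ring
  have hG4 : CodeFP unE unE (fun n => 4 * (2 * Φ.Fb n + 2)) := (unAdd.comp (hG2.pair hG2)).congr fun n => by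
    show 2 * (2 * Φ.Fb n + 2) + 2 * (2 * Φ.Fb n + 2) = _; ring
  have hG8 : CodeFP unE unE (fun n => 8 * (2 * Φ.Fb n + 2)) := (unAdd.comp (hG4.pair hG4)).congr fun n => by
    show 4 * (2 * Φ.Fb n + 2) + 4 * (2 * Φ.Fb n + 2) = _; ring
  exact (unAdd.comp ((unAdd.comp ((unAdd.comp ((CodeFP.id unE).pair (CodeFP.id unE))).pair (const _ 2))).pair hG8)).congr
    fun n => by show n + n + 2 + 8 * (2 * Φ.Fb n + 2) = Φ.Lreq n; unfold SuccIntMatrixFamily.Lreq; ring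

/-- ★ **The output gate names are polynomial-time in `(1ⁿ, 1ˢ, c)`.** [cite: KoiranPerifel2009VPSPACE, §3.2; AroraBarak2009, §6.8 Def. 6.30] -/
theorem codeFP_outName : CodeFP (pairE unE (pairE unE natE)) strE (fun p => outName Φ p.1 p.2.1 p.2.2) := by
  have hn : CodeFP (pairE unE (pairE unE natE)) unE (fun p => p.1) := CodeFP.fst _ _
  have hs : CodeFP (pairE unE (pairE unE natE)) natE (fun p => p.2.1) :=
    (natOfUn.comp ((CodeFP.fst _ _).comp (CodeFP.snd _ _))).congr fun _ => rfl
  have hc : CodeFP (pairE unE (pairE unE natE)) natE (fun p => p.2.2) :=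
    ((CodeFP.snd _ _).comp (CodeFP.snd _ _)).congr fun _ => rfl
  have ht : CodeFP (pairE unE (pairE unE natE)) (rawE natE) (fun p => [29, p.2.1, p.2.2, 0, 0, 0, 0, 0]) :=
    ((rawCons natE).comp ((const _ 29).pair ((rawCons natE).comp (hs.pair ((rawCons natE).comp (hc.pair
      (const _ [0, 0, 0, 0, 0]))))))).congr fun _ => rfl
  exact (codeFP_gname.comp (((fp_Lreq_un Φ).comp hn).pair (hn.pair ht))).congr fun _ => rfl

/-- ★★★ **Theorem (the succinct kernel-vector circuit is correct).** For every `FP` integer matrix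
family `Φ` and every `n` with `N n ≥ 2`, the designated output gates `V(0, c)`, `V(1, c)` of the
`FP`-succinct circuit `KVC.kvc Φ` carry the positive and negative parts of the canonical kernel
vector of the Gram matrix: `val V(0,c) − val V(1,c) = charpolyKernelVector (AᵀA) c`, where
`A = Φ.A n` on `Fin (R n) × Fin (N n)`. (Mahajan–Vinay's all-coefficients matrix for `χ_{AᵀA}`,
Borodin–von zur Gathen–Hopcroft's `q_B(B)·B^{j₀−1}` and least nonzero column, all as one
constant-depth-of-selects arithmetic circuit; with p1's `bitLang_mem_PSPACE` its bits are in
`PSPACE`.) [cite: BorodinVonzurgathenHopcroft1982, Thm. 2 and §5 (NULLSPACE)] [cite: MahajanVinay1999, Thm. 3.2] [cite: KoiranPerifel2009VPSPACE, §3.2, Prop. 1] [cite: KumarVolk2022, §6 (proof of Cor. 1.3)] -/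
theorem outName_val_sub (hN : 2 ≤ Φ.N n) (c : Fin (Φ.N n)) :
    ((kvc Φ).val (outName Φ n 0 c) : ℤ) - (kvc Φ).val (outName Φ n 1 c) =
      charpolyKernelVector ((Amat Φ n).transpose * Amat Φ n) c := by
  rw [← kvZ_eq_gram Φ hN c]
  exact V_V_sub Φ hN c.isLt

/-- The output names have the required length `Lreq n`. [cite: KoiranPerifel2009VPSPACE, §3.2] -/
theorem length_outName (n s c : ℕ) : (outName Φ n s c).length = Φ.Lreq n := length_gname _ _ _

end Output

end KVC

end Literature.Computability.Complexity

end
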